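import Mathlib.Algebra.BigOperators.GroupWithZero.Finset
import Mathlib.Algebra.BigOperators.Ring.Finset
import Mathlib.Algebra.BigOperators.Fin
import Mathlib.Algebra.Ring.BooleanRing
import Mathlib.LinearAlgebra.FiniteDimensional.Lemmas
import Mathlib.Tactic.IntervalCases
import Literature.Computability.QuantumComplexity.CliffordCodeOperator

/-!
# Proof of the Clifford commutant theorem (Gross–Nezami–Walter, Thm. 4.3, qubit case)

This file discharges the named fact `CliffordCommutantTheorem` of
`Literature/Computability/QuantumComplexity/CliffordCodeOperator.lean`:

* `CliffordCommutantTheorem_holds : CliffordCommutantTheorem` — for all `t, n` with `t - 1 ≤ n`,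
  (i) `|Σ_{t,t}(2)| = ∏_{k<t-1} (2^k + 1)`, (ii) the operators `R(T) = r(T)^{⊗n}`, `T ∈ Σ_{t,t}(2)`,
  are `ℂ`-linearly independent, (iii) their span is the commutant `cliffordCommutant t n` of
  `{C^{⊗t} : C ∈ cliffordCircuits n}` [GNW21, Thm. 4.3 (= Thm. 1.1), `d = 2`].

## Architecture of the proof

All of it takes place on `Col t = QReg t × QReg t = 𝔽₂^t × 𝔽₂^t` with the additive group
structure of Mathlib's `BooleanRing Bool` (`+` = xor, `1` = the all-ones vector `1_{2t}`), using
finite character sums only (no Mathlib linear algebra over `𝔽₂` is needed):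

* `sgn`, `bilin` (the form `β`), orthogonality `sum_sgn_bilin`; subgroups-as-finsets `IsSub`,
  `perp` with `|S| |S^⊥| = 4^t` and `S^⊥⊥ = S`; the quadratic character `qchar v = i^{𝔮(v)}`
  (`qchar_eq_one_iff` : `χ(v) = 1 ↔ |x| ≡ |y| (mod 4)`), polarisation `qchar_add`, Gauss sums.
* (i) `card_lagrAbove_aux` / `natCard_stochasticLagrangian`: the number of `T ∈ Σ_{t,t}(2)` above a
  stochastic totally isotropic subgroup `S`, `|S| = 2^{t-j}`, is `∏_{i<j} (2^i+1)`, by induction on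
  `j` (double counting pairs `(w, T)`, `w ∈ T ∖ S`, with `2 #{w ∈ S^⊥ isotropic} = |S^⊥| + 2^t`
  from `G(S^⊥) = 2^t`). This elementary recursion REPLACES the `(X, A)`-parametrisation and the
  `q`-binomial theorem of [GNW21, proof of Thm. 4.8]; the statement is [GNW21, Thm. 4.8].
* (ii) `linearIndependent_cliffordCodeOperator`: [GNW21, Lem. 4.5] verbatim — evaluate a linear
  relation at the entry indexed by the reference tuple `refCols` `(g₁,…,g_{t-1}, 1_{2t}, 0,…)` of a
  basis of `T` through `1_{2t}` (`IsLagr.exists_gen`).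
* (iii, ⊆) `cliffordCodeOperator_mem_cliffordCommutant`: [GNW21, Lem. 4.3], generator by generator
  (`H`: `T = T^⊥`, `hada_core`; `S`: total isotropy; `CNOT`: subspace), after translating
  commutation with the placements of `H`, `S`, `CNOT` into three relations on the entry function
  `entryFun A (V) = A_{z,w}` (`V` = the `n` columns of `(z, w)`): `commute_hGate_iff`,
  `commute_sGate_iff`, `commute_cnot_iff`, and `mem_cliffordCommutant_iff_placements`.
* (iii, ⊇) `IsCliffInv.vanishing`: an entry function satisfying the three relations and vanishing
  on the reference tuple of every `T ∈ Σ_{t,t}(2)` is zero; hence `dim (commutant) ≤ |Σ_{t,t}(2)|`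
  (`span_cliffordCodeOperator_eq`). Ingredients: column additions act transitively on tuples with
  a given span (`IsColAddInv.eq_of_spanF_eq`, i.e. `CNOT` circuits realise `GL_n(𝔽₂)`), support
  on totally isotropic spans (`IsCliffInv.qchar_of_mem_spanF`), complement invariance
  `f(U, v + 1_{2t}) = f(U, v)` (`IsCliffInv.snoc_add_one`), the boundary case `n = t - 1`
  (`IsCliffInv.eq_of_complements`, `IsCliffInv.typeB`) and the descent
  `f(V) = 2^{-t} |span V| f(V)`. This REPLACES the Weyl-twirl / symplectic-orbit / Witt-theorem
  dimension count of [GNW21, Lem. 4.6 and Thm. 4.7] by an elementary argument in the vectorised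
  ("code") picture, cf. [GNW21, Rem. 4.2 and Rem. 4.4] (Nebe–Rains–Sloane); the resulting
  dimension statement is [GNW21, Thm. 4.7].
* `t = 0` is degenerate (`cliffordCommutantTheorem_zero`: one Lagrangian, `1 × 1` matrices).

## References (numbering)

* [GNW21] D. Gross, S. Nezami, M. Walter, *Schur–Weyl duality for the Clifford group with
  applications: property testing, a robust Hudson theorem, and de Finetti representations*,
  Comm. Math. Phys. 385 (2021) 1325–1393, doi:10.1007/s00220-021-04118-7, arXiv:1712.08628.
  Locators in this file follow the arXiv version read here (§4.1: Lem. 4.3 = commutation,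
  Lem. 4.5 = linear independence, Lem. 4.6/Thm. 4.7 = dimension of the commutant, Thm. 4.8 =
  cardinality of `Σ_{t,t}`); the published numbering is shifted by two (Lem. 4.5, Lem. 4.7,
  Thm. 4.9, Thm. 4.10, and Thm. 4.3 for the main theorem), as recorded in `CliffordCodeOperator.lean`.
  Bib key `GrossNezamiWalter2021`.
* G. Nebe, E. M. Rains, N. J. A. Sloane, *Self-dual codes and invariant theory*, Springer (2006),
  for the code picture of the commutant ([GNW21, Rem. 4.4]).

## Design choices

* No new definitions of mathematical content are introduced beyond proof devices (`Col`, `sgn`,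
  `bilin`, `qchar`, `perp`, `adjoin`, `IsSub`, `IsLagr` (shown equivalent to
  `IsStochasticLagrangian`, `isLagr_iff`), `bcomb`/`spanF`, `refCols`, `entryFun`, …); no named
  facts (D-0026). Everything is sorry-free and uses only `propext`, `Classical.choice`, `Quot.sound`.
* The `𝔽₂`-linear algebra is done with finsets closed under `+` and cardinalities (`2^k`), which
  matches the finset encoding of `IsStochasticLagrangian` in the statement file.
-/

noncomputable section

open Matrix Complex Finset

namespace Literature.Computability.QuantumComplexity

open Cryptography (QReg)

namespace CliffordCommutant

variable {t : ℕ}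

/-- A column vector `(x, y) ∈ 𝔽₂^t × 𝔽₂^t`; an additive group (indeed a Boolean ring) under
coordinatewise xor via Mathlib's `BooleanRing Bool`. [folklore] -/
abbrev Col (t : ℕ) : Type := QReg t × QReg t

namespace Col

/-- `v + v = 0` in `𝔽₂^{2t}`. [folklore] -/
@[simp] theorem add_self (v : Col t) : v + v = 0 := by
  ext j <;> exact BooleanRing.add_self _

/-- `v + (v + w) = w`. [folklore] -/
@[simp] theorem add_add_cancel_left (v w : Col t) : v + (v + w) = w := by
  rw [← add_assoc, add_self, zero_add]

/-- `(v + w) + w = v`. [folklore] -/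
@[simp] theorem add_add_cancel_right (v w : Col t) : v + w + w = v := by
  rw [add_assoc, add_self, add_zero]

/-- The all-ones vector `1_{2t}` is the ring unit of `Col t`. [folklore] -/
theorem one_eq : (1 : Col t) = ((fun _ => true), (fun _ => true)) := rfl

/-- The zero vector. [folklore] -/
theorem zero_eq : (0 : Col t) = ((fun _ => false), (fun _ => false)) := rfl

/-- Coordinatewise description of addition (xor). [folklore] -/
theorem add_eq (p q : Col t) :
    p + q = ((fun j => Bool.xor (p.1 j) (q.1 j)), (fun j => Bool.xor (p.2 j) (q.2 j))) := rfl

end Col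

/-! ### The sign character and the bilinear form `β` -/

/-- `sgn b = (-1)^b`. [folklore] -/
def sgn (b : Bool) : ℂ := if b = true then -1 else 1

/-- Auxiliary (theorem `sgn_true`): sgn true. [folklore] -/
@[simp] theorem sgn_true : sgn true = -1 := rfl
/-- Auxiliary (theorem `sgn_false`): sgn false. [folklore] -/
@[simp] theorem sgn_false : sgn false = 1 := rfl

/-- `sgn` is a character of `(𝔽₂, +)`. [folklore] -/
theorem sgn_add (a b : Bool) : sgn (a + b) = sgn a * sgn b := by
  cases a <;> cases b <;> simp [sgn, Bool.add_eq_xor]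

/-- Auxiliary (theorem `sgn_ne_zero`): sgn ne zero. [folklore] -/
theorem sgn_ne_zero (b : Bool) : sgn b ≠ 0 := by
  cases b <;> simp [sgn]

/-- Auxiliary (theorem `sgn_mul_self`): sgn mul self. [folklore] -/
theorem sgn_mul_self (b : Bool) : sgn b * sgn b = 1 := by
  cases b <;> simp [sgn]

/-- Auxiliary (theorem `sgn_eq_one_iff`): sgn eq one iff. [folklore] -/
theorem sgn_eq_one_iff (b : Bool) : sgn b = 1 ↔ b = false := by
  cases b <;> simp [sgn]
  intro h
  have := congrArg Complex.re h
  norm_num at this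

/-- `sgn (∑ bᵢ) = ∏ sgn bᵢ`. [folklore] -/
theorem sgn_sum {ι : Type*} (s : Finset ι) (b : ι → Bool) :
    sgn (∑ i ∈ s, b i) = ∏ i ∈ s, sgn (b i) := by
  classical
  induction s using Finset.induction_on with
  | empty => simp [sgn]
  | insert a s ha ih => rw [Finset.sum_insert ha, Finset.prod_insert ha, sgn_add, ih]

/-- The symmetric bilinear form `β((x,y),(x',y')) = x·x' + y·y'` on `𝔽₂^t × 𝔽₂^t` (over `𝔽₂`,
`-1 = 1`, so this is also `x·x' - y·y'`). [cite: GrossNezamiWalter2021, Rem. before Thm. 4.3 (the form β)] -/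
def bilin (v w : Col t) : Bool := v.1 ⬝ᵥ w.1 + v.2 ⬝ᵥ w.2

/-- Auxiliary (theorem `bilin_comm`): bilin comm. [folklore] -/
theorem bilin_comm (v w : Col t) : bilin v w = bilin w v := by
  simp [bilin, dotProduct_comm]

/-- Auxiliary (theorem `bilin_add_left`): bilin add left. [folklore] -/
theorem bilin_add_left (u v w : Col t) : bilin (u + v) w = bilin u w + bilin v w := by
  simp only [bilin, Prod.fst_add, Prod.snd_add, add_dotProduct]
  abel

/-- Auxiliary (theorem `bilin_add_right`): bilin add right. [folklore] -/
theorem bilin_add_right (u v w : Col t) : bilin u (v + w) = bilin u v + bilin u w := by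
  rw [bilin_comm, bilin_add_left, bilin_comm v, bilin_comm w]

/-- Auxiliary (theorem `bilin_zero_left`): bilin zero left. [folklore] -/
@[simp] theorem bilin_zero_left (w : Col t) : bilin 0 w = false := by
  simp [bilin, Bool.zero_eq_false]

/-- Auxiliary (theorem `bilin_zero_right`): bilin zero right. [folklore] -/
@[simp] theorem bilin_zero_right (w : Col t) : bilin w 0 = false := by
  simp [bilin, Bool.zero_eq_false]

/-- `sgn β(v, w)` factorises over the coordinates. [folklore] -/
theorem sgn_bilin (v w : Col t) :
    sgn (bilin v w) = (∏ j, sgn (v.1 j * w.1 j)) * ∏ j, sgn (v.2 j * w.2 j) := by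
  rw [bilin, sgn_add, dotProduct, dotProduct, sgn_sum, sgn_sum]

/-- `∑_{b ∈ 𝔽₂} (-1)^{a b} = 2 [a = 0]`. [folklore] -/
theorem sum_sgn_mul (a : Bool) : ∑ b : Bool, sgn (a * b) = if a = true then 0 else 2 := by
  rw [Fintype.sum_bool]
  cases a <;> norm_num [sgn, Bool.mul_eq_and]

/-- One-component orthogonality: `∑_{x'} (-1)^{x·x'} = 2^t [x = 0]`. [folklore] -/
theorem sum_prod_sgn (x : QReg t) :
    ∑ x' : QReg t, ∏ j, sgn (x j * x' j) = if x = (fun _ => false) then (2 : ℂ) ^ t else 0 := by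
  rw [← Fintype.prod_sum fun j b => sgn (x j * b)]
  simp_rw [sum_sgn_mul]
  split_ifs with h
  · subst h
    simp
  · have : ∃ j, x j = true := by
      by_contra hne
      push Not at hne
      exact h (funext fun j => by simpa using hne j)
    obtain ⟨j, hj⟩ := this
    exact Finset.prod_eq_zero (Finset.mem_univ j) (by simp [hj])

/-- **Orthogonality of characters** on `𝔽₂^{2t}`: `∑_w (-1)^{β(v,w)} = 4^t [v = 0]`. [folklore] -/
theorem sum_sgn_bilin (v : Col t) :
    ∑ w : Col t, sgn (bilin v w) = if v = 0 then (4 : ℂ) ^ t else 0 := by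
  simp_rw [sgn_bilin]
  rw [Fintype.sum_prod_type]
  dsimp only
  rw [← Finset.sum_mul_sum, sum_prod_sgn, sum_prod_sgn]
  have h4 : (4 : ℂ) ^ t = 2 ^ t * 2 ^ t := by rw [← mul_pow]; norm_num
  by_cases hv : v = 0
  · subst hv
    simp [h4, Col.zero_eq]
  · rw [if_neg hv]
    have : ¬ (v.1 = (fun _ => false) ∧ v.2 = (fun _ => false)) := fun h =>
      hv (Prod.ext h.1 h.2)
    by_cases h1 : v.1 = (fun _ => false)
    · have h2 : ¬ v.2 = (fun _ => false) := fun h2 => this ⟨h1, h2⟩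
      simp [h1, h2]
    · simp [h1]

/-! ### Subgroups of `𝔽₂^{2t}` as finsets, and their orthogonals -/

/-- A finset of column vectors that is an additive subgroup (contains `0`, closed under `+`). [folklore] -/
structure IsSub (S : Finset (Col t)) : Prop where
  zero_mem : (0 : Col t) ∈ S
  add_mem : ∀ a ∈ S, ∀ b ∈ S, a + b ∈ S

/-- The orthogonal `S^⊥ = {w : β(s, w) = 0 ∀ s ∈ S}`. [cite: GrossNezamiWalter2021, Rem. before Thm. 4.3 (T^⊥)] -/
def perp (S : Finset (Col t)) : Finset (Col t) :=
  Finset.univ.filter fun w => ∀ s ∈ S, bilin s w = false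

/-- Auxiliary (theorem `mem_perp`): mem perp. [folklore] -/
@[simp] theorem mem_perp {S : Finset (Col t)} {w : Col t} :
    w ∈ perp S ↔ ∀ s ∈ S, bilin s w = false := by
  simp [perp]

/-- Auxiliary (theorem `isSub_perp`): isSub perp. [folklore] -/
theorem isSub_perp (S : Finset (Col t)) : IsSub (perp S) := by
  refine ⟨by simp, fun a ha b hb => ?_⟩
  rw [mem_perp] at ha hb ⊢
  intro s hs
  rw [bilin_add_right, ha s hs, hb s hs]
  rfl

/-- Auxiliary (theorem `perp_antitone`): perp antitone. [folklore] -/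
theorem perp_antitone {S T : Finset (Col t)} (h : S ⊆ T) : perp T ⊆ perp S := fun _ hw =>
  mem_perp.2 fun s hs => mem_perp.1 hw s (h hs)

/-- Auxiliary (theorem `subset_perp_perp`): subset perp perp. [folklore] -/
theorem subset_perp_perp (S : Finset (Col t)) : S ⊆ perp (perp S) := fun s hs =>
  mem_perp.2 fun w hw => by rw [bilin_comm]; exact mem_perp.1 hw s hs

/-- **Character sum over a subgroup**: `∑_{s ∈ S} (-1)^{β(s,w)} = |S| [w ∈ S^⊥]`. [folklore] -/
theorem sum_sgn_bilin_sub {S : Finset (Col t)} (hS : IsSub S) (w : Col t) :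
    ∑ s ∈ S, sgn (bilin s w) = if w ∈ perp S then (S.card : ℂ) else 0 := by
  split_ifs with hw
  · rw [mem_perp] at hw
    rw [Finset.sum_congr rfl fun s hs => by rw [hw s hs, sgn_false], Finset.sum_const, nsmul_eq_mul,
      mul_one]
  · rw [mem_perp] at hw
    push Not at hw
    obtain ⟨s₀, hs₀, hne⟩ := hw
    have hs₀w : bilin s₀ w = true := by simpa using hne
    have hs₀0 : s₀ ≠ 0 := by
      rintro rfl
      simp at hs₀w
    refine Finset.sum_involution (fun a _ => a + s₀) (fun a _ => ?_) (fun a _ _ => ?_)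
      (fun a ha => hS.add_mem a ha s₀ hs₀) (fun a _ => Col.add_add_cancel_right a s₀)
    · rw [bilin_add_left, sgn_add, hs₀w, sgn_true]
      ring
    · intro h
      exact hs₀0 (by simpa using h)

/-- `|S^⊥| · |S| = 4^t` for a subgroup `S`. [folklore] -/
theorem card_perp_mul_card {S : Finset (Col t)} (hS : IsSub S) :
    (perp S).card * S.card = 4 ^ t := by
  have key : ∑ w : Col t, ∑ s ∈ S, sgn (bilin s w) = (4 : ℂ) ^ t := by
    rw [Finset.sum_comm]
    simp_rw [sum_sgn_bilin]
    rw [Finset.sum_ite_eq' S (0 : Col t) (fun _ => (4 : ℂ) ^ t)]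
    simp [hS.zero_mem]
  simp_rw [sum_sgn_bilin_sub hS] at key
  rw [Finset.sum_ite, Finset.sum_const_zero, add_zero, Finset.sum_const, nsmul_eq_mul] at key
  have : (Finset.univ.filter fun w => w ∈ perp S) = perp S := by ext; simp
  rw [this] at key
  exact_mod_cast key

/-- Auxiliary (theorem `card_perp_pos`): card perp pos. [folklore] -/
theorem card_perp_pos (S : Finset (Col t)) : 0 < (perp S).card :=
  Finset.card_pos.2 ⟨0, (isSub_perp S).zero_mem⟩

/-- `S^⊥⊥ = S` for a subgroup `S` (the form `β` is nondegenerate). [folklore] -/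
theorem perp_perp {S : Finset (Col t)} (hS : IsSub S) : perp (perp S) = S := by
  symm
  apply Finset.eq_of_subset_of_card_le (subset_perp_perp S)
  have h1 := card_perp_mul_card hS
  have h2 := card_perp_mul_card (isSub_perp S)
  have hpos := card_perp_pos S
  have : (perp (perp S)).card * (perp S).card = S.card * (perp S).card := by
    rw [h2, ← h1, mul_comm]
  exact (Nat.eq_of_mul_eq_mul_right hpos this).le

/-! ### The quadratic character `i^{𝔮(v)}`, `𝔮(x,y) = |x| - |y| (mod 4)` -/

/-- `i^a` for a bit `a`. [folklore] -/
def cI (b : Bool) : ℂ := if b = true then I else 1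

/-- `(-i)^a` for a bit `a`. [folklore] -/
def cJ (b : Bool) : ℂ := if b = true then -I else 1

/-- The quadratic character `χ(x, y) = i^{|x|} (-i)^{|y|} = i^{𝔮(x,y)}` of `v = (x, y)`,
`𝔮(x,y) = x·x - y·y ∈ ℤ/4`. [cite: GrossNezamiWalter2021, Def. 4.1 (the form 𝔮)] -/
def qchar (v : Col t) : ℂ := (∏ j, cI (v.1 j)) * ∏ j, cJ (v.2 j)

/-- Auxiliary (theorem `cI_add`): cI add. [folklore] -/
theorem cI_add (a b : Bool) : cI (a + b) = cI a * cI b * sgn (a * b) := by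
  cases a <;> cases b <;> simp [cI, sgn, Bool.add_eq_xor, Bool.mul_eq_and]

/-- Auxiliary (theorem `cJ_add`): cJ add. [folklore] -/
theorem cJ_add (a b : Bool) : cJ (a + b) = cJ a * cJ b * sgn (a * b) := by
  cases a <;> cases b <;> simp [cJ, sgn, Bool.add_eq_xor, Bool.mul_eq_and]

/-- Auxiliary (theorem `cI_mul_cJ`): cI mul cJ. [folklore] -/
theorem cI_mul_cJ (a : Bool) : cI a * cJ a = 1 := by
  cases a <;> simp [cI, cJ]

/-- **Polarisation**: `χ(v + w) = χ(v) χ(w) (-1)^{β(v,w)}`, i.e.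
`𝔮(v + w) = 𝔮(v) + 𝔮(w) + 2β(v,w) (mod 4)`. [cite: GrossNezamiWalter2021, Rem. before Thm. 4.3 (eq. bilinear vs quadratic form)] -/
theorem qchar_add (v w : Col t) : qchar (v + w) = qchar v * qchar w * sgn (bilin v w) := by
  simp only [qchar, Prod.fst_add, Prod.snd_add, Pi.add_apply, cI_add, cJ_add, Finset.prod_mul_distrib,
    sgn_bilin]
  ring

/-- Auxiliary (theorem `qchar_zero`): qchar zero. [folklore] -/
@[simp] theorem qchar_zero : qchar (0 : Col t) = 1 := by
  simp [qchar, cI, cJ, Col.zero_eq]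

/-- Auxiliary (theorem `qchar_one`): qchar one. [folklore] -/
@[simp] theorem qchar_one : qchar (1 : Col t) = 1 := by
  simp only [qchar, Col.one_eq, ← Finset.prod_mul_distrib, cI_mul_cJ, Finset.prod_const_one]

/-- `χ(v)² (-1)^{β(1,v)} = 1` (since `β(v,v) = β(1,v)` over `𝔽₂`). [folklore] -/
theorem qchar_mul_qchar_mul_sgn (v : Col t) : qchar v * qchar v * sgn (bilin 1 v) = 1 := by
  have h := qchar_add v v
  rw [Col.add_self, qchar_zero] at h
  have hb : bilin v v = bilin 1 v := by
    simp only [bilin, dotProduct]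
    congr 1 <;> refine Finset.sum_congr rfl fun j _ => ?_
    · cases v.1 j <;> rfl
    · cases v.2 j <;> rfl
  rw [← hb]
  exact h.symm

/-- An isotropic vector is orthogonal to `1_{2t}`. [cite: GrossNezamiWalter2021, Rem. before Thm. 4.3 (β(v,1) = 𝔮(v) mod 2)] -/
theorem bilin_one_eq_false_of_qchar {v : Col t} (hv : qchar v = 1) : bilin 1 v = false := by
  have h := qchar_mul_qchar_mul_sgn v
  rw [hv, one_mul, one_mul, sgn_eq_one_iff] at h
  exact h

/-- A vector orthogonal to `1_{2t}` has `χ(v) = ±1`. [folklore] -/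
theorem qchar_eq_or_of_bilin_one {v : Col t} (hv : bilin 1 v = false) : qchar v = 1 ∨ qchar v = -1 := by
  have h := qchar_mul_qchar_mul_sgn v
  rw [hv, sgn_false, mul_one] at h
  exact mul_self_eq_one_iff.1 h

/-- `i^a = i^b ↔ a ≡ b (mod 4)`. [folklore] -/
theorem I_pow_eq_I_pow_iff (a b : ℕ) : I ^ a = I ^ b ↔ a % 4 = b % 4 := by
  have hmod : ∀ n : ℕ, I ^ n = I ^ (n % 4) := fun n => by
    conv_lhs => rw [← Nat.div_add_mod n 4, pow_add, pow_mul, Complex.I_pow_four, one_pow, one_mul]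
  rw [hmod a, hmod b]
  have ha := Nat.mod_lt a (by norm_num : 0 < 4)
  have hb := Nat.mod_lt b (by norm_num : 0 < 4)
  generalize a % 4 = r at ha ⊢
  generalize b % 4 = r' at hb ⊢
  constructor
  · intro h
    interval_cases r <;> interval_cases r' <;> first | rfl | norm_num [pow_succ, Complex.ext_iff] at h
  · rintro rfl
    rfl

/-- Auxiliary (theorem `prod_cI_eq_pow`): prod cI eq pow. [folklore] -/
theorem prod_cI_eq_pow (x : QReg t) :
    ∏ j, cI (x j) = I ^ (Finset.univ.filter fun j => x j = true).card := by
  simp only [cI]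
  rw [Finset.prod_ite, Finset.prod_const_one, mul_one, Finset.prod_const]

/-- Auxiliary (theorem `prod_cJ_eq_pow`): prod cJ eq pow. [folklore] -/
theorem prod_cJ_eq_pow (x : QReg t) :
    ∏ j, cJ (x j) = (-I) ^ (Finset.univ.filter fun j => x j = true).card := by
  simp only [cJ]
  rw [Finset.prod_ite, Finset.prod_const_one, mul_one, Finset.prod_const]

/-- `χ(x, y) = 1 ↔ |x| ≡ |y| (mod 4)`, i.e. `v` is `𝔮`-isotropic. [cite: GrossNezamiWalter2021, Def. 4.1 (total isotropy)] -/
theorem qchar_eq_one_iff (v : Col t) :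
    qchar v = 1 ↔ (Finset.univ.filter fun j => v.1 j = true).card % 4 =
      (Finset.univ.filter fun j => v.2 j = true).card % 4 := by
  rw [qchar, prod_cI_eq_pow, prod_cJ_eq_pow, ← I_pow_eq_I_pow_iff]
  generalize (Finset.univ.filter fun j => v.1 j = true).card = a
  generalize (Finset.univ.filter fun j => v.2 j = true).card = b
  have hIJ : (-I) ^ b * I ^ b = 1 := by rw [← mul_pow]; simp
  constructor
  · intro h
    calc I ^ a = I ^ a * ((-I) ^ b * I ^ b) := by rw [hIJ, mul_one]
      _ = I ^ b := by rw [← mul_assoc, h, one_mul]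
  · intro h
    rw [h]
    calc I ^ b * (-I) ^ b = (-I) ^ b * I ^ b := mul_comm _ _
      _ = 1 := hIJ

/-- **Gauss sum**: `∑_{v ∈ 𝔽₂^{2t}} i^{𝔮(v)} = (1+i)^t (1-i)^t = 2^t`. [folklore] -/
theorem sum_qchar : ∑ v : Col t, qchar v = (2 : ℂ) ^ t := by
  simp only [qchar]
  rw [Fintype.sum_prod_type]
  dsimp only
  rw [← Finset.sum_mul_sum, ← Fintype.prod_sum fun _ b => cI b, ← Fintype.prod_sum fun _ b => cJ b]
  simp only [Fintype.sum_bool, cI, cJ, if_true]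
  rw [Finset.prod_const, Finset.prod_const, Finset.card_univ, Fintype.card_fin, ← mul_pow]
  congr 1
  simp only [Bool.false_eq_true, if_false]
  ring_nf
  rw [Complex.I_sq]
  ring

/-- Shifted Gauss sum: `∑_v (-1)^{β(s,v)} i^{𝔮(v)} = 2^t` for isotropic `s`. [folklore] -/
theorem sum_sgn_mul_qchar {s : Col t} (hs : qchar s = 1) :
    ∑ v : Col t, sgn (bilin s v) * qchar v = (2 : ℂ) ^ t := by
  have : ∀ v, sgn (bilin s v) * qchar v = qchar (v + s) := fun v => by
    rw [qchar_add, hs, mul_one, bilin_comm, mul_comm]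
  simp_rw [this]
  rw [← sum_qchar (t := t)]
  exact Fintype.sum_equiv (Equiv.addRight s) _ _ fun v => rfl

/-- `G(S^⊥) = ∑_{w ∈ S^⊥} i^{𝔮(w)} = 2^t` for every totally isotropic subgroup `S`
(projection formula + shifted Gauss sum). [folklore] -/
theorem sum_qchar_perp {S : Finset (Col t)} (hS : IsSub S) (hiso : ∀ s ∈ S, qchar s = 1) :
    ∑ w ∈ perp S, qchar w = (2 : ℂ) ^ t := by
  have hcard : (S.card : ℂ) ≠ 0 := by
    exact_mod_cast (Finset.card_pos.2 ⟨0, hS.zero_mem⟩).ne'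
  apply mul_left_cancel₀ hcard
  have h1 : (S.card : ℂ) * ∑ w ∈ perp S, qchar w = ∑ w : Col t, (∑ s ∈ S, sgn (bilin s w)) * qchar w := by
    simp_rw [sum_sgn_bilin_sub hS, ite_mul, zero_mul]
    rw [Finset.sum_ite, Finset.sum_const_zero, add_zero, Finset.mul_sum]
    apply Finset.sum_congr (by ext; simp) fun _ _ => rfl
  rw [h1]
  simp_rw [Finset.sum_mul]
  rw [Finset.sum_comm, Finset.sum_congr rfl fun s hs => sum_sgn_mul_qchar (hiso s hs), Finset.sum_const,
    nsmul_eq_mul]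


/-! ### Totally isotropic subgroups -/

section Iso

variable {S : Finset (Col t)}

/-- A totally `𝔮`-isotropic subgroup is self-orthogonal: `S ⊆ S^⊥`.
[cite: GrossNezamiWalter2021, Rem. before Thm. 4.3 (totally isotropic ⟹ T ⊆ T^⊥)] -/
theorem subset_perp_of_iso (hS : IsSub S) (hiso : ∀ v ∈ S, qchar v = 1) : S ⊆ perp S := by
  intro s hs
  rw [mem_perp]
  intro s' hs'
  have h := qchar_add s' s
  rw [hiso _ (hS.add_mem _ hs' _ hs), hiso _ hs', hiso _ hs, one_mul, one_mul] at h
  exact (sgn_eq_one_iff _).1 h.symm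

/-- A totally isotropic subgroup of `𝔽₂^{2t}` has at most `2^t` elements ("`t` is the maximal
possible dimension"). [cite: GrossNezamiWalter2021, Def. 4.1 (Lagrangian = dimension t)] -/
theorem card_le_of_iso (hS : IsSub S) (hiso : ∀ v ∈ S, qchar v = 1) : S.card ≤ 2 ^ t := by
  have h1 := card_perp_mul_card hS
  have h2 : S.card ≤ (perp S).card := Finset.card_le_card (subset_perp_of_iso hS hiso)
  have h3 : S.card * S.card ≤ 2 ^ t * 2 ^ t := by
    calc S.card * S.card ≤ (perp S).card * S.card := Nat.mul_le_mul_right _ h2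
      _ = 4 ^ t := h1
      _ = 2 ^ t * 2 ^ t := by rw [← mul_pow]; norm_num
  exact Nat.mul_self_le_mul_self_iff.1 h3

/-- A Lagrangian (`|T| = 2^t`, totally isotropic) subgroup satisfies `T^⊥ = T`.
[cite: GrossNezamiWalter2021, proof of Lem. 4.3 (T = T^⊥ for Lagrangian T)] -/
theorem perp_eq_of_card (hS : IsSub S) (hiso : ∀ v ∈ S, qchar v = 1) (hc : S.card = 2 ^ t) :
    perp S = S := by
  symm
  apply Finset.eq_of_subset_of_card_le (subset_perp_of_iso hS hiso)
  have h1 := card_perp_mul_card hS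
  rw [hc, show (4 : ℕ) ^ t = 2 ^ t * 2 ^ t by rw [← mul_pow]; norm_num] at h1
  have := Nat.eq_of_mul_eq_mul_right (Nat.pos_of_ne_zero (by positivity)) h1
  omega

/-- For `d = 2` a Lagrangian subspace is automatically stochastic: `1_{2t} ∈ T`.
[cite: GrossNezamiWalter2021, Rem. before Thm. 4.3 (d = 2: Lagrangian ⟹ stochastic)] -/
theorem one_mem_of_card (hS : IsSub S) (hiso : ∀ v ∈ S, qchar v = 1) (hc : S.card = 2 ^ t) :
    (1 : Col t) ∈ S := by
  rw [← perp_eq_of_card hS hiso hc, mem_perp]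
  intro s hs
  rw [bilin_comm]
  exact bilin_one_eq_false_of_qchar (hiso s hs)

/-- The number `Z` of isotropic vectors in `S^⊥`, for a stochastic totally isotropic subgroup `S`:
`2 Z = |S^⊥| + 2^t` (from `G(S^⊥) = 2^t` and `χ = ±1` on `S^⊥ ⊆ 1^⊥`). [folklore] -/
theorem two_mul_card_iso_perp (hS : IsSub S) (hiso : ∀ v ∈ S, qchar v = 1) (h1 : (1 : Col t) ∈ S) :
    2 * ((perp S).filter fun w => qchar w = 1).card = (perp S).card + 2 ^ t := by
  have key := sum_qchar_perp hS hiso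
  have hpm : ∀ w ∈ perp S, qchar w = if qchar w = 1 then (1 : ℂ) else -1 := by
    intro w hw
    have hb : bilin 1 w = false := mem_perp.1 hw 1 h1
    rcases qchar_eq_or_of_bilin_one hb with h | h
    · rw [h, if_pos rfl]
    · rw [h, if_neg]
      norm_num
  rw [Finset.sum_congr rfl hpm, Finset.sum_ite, Finset.sum_const, Finset.sum_const, nsmul_eq_mul,
    nsmul_eq_mul, mul_one, mul_neg, mul_one] at key
  have hsplit := Finset.card_filter_add_card_filter_not (s := perp S) (fun w => qchar w = 1)
  have key' : (((perp S).filter fun w => qchar w = 1).card : ℂ) =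
      ((perp S).filter fun w => ¬ qchar w = 1).card + 2 ^ t := by
    rw [← key]
    ring
  have : ((perp S).filter fun w => qchar w = 1).card =
      ((perp S).filter fun w => ¬ qchar w = 1).card + 2 ^ t := by exact_mod_cast key'
  omega

end Iso

/-! ### Adjoining a vector to a subgroup -/

/-- `S + 𝔽₂ w = S ∪ (S + w)`. [folklore] -/
def adjoin (S : Finset (Col t)) (w : Col t) : Finset (Col t) := S ∪ S.image (· + w)

/-- Auxiliary (theorem `mem_adjoin`): mem adjoin. [folklore] -/
theorem mem_adjoin {S : Finset (Col t)} {w v : Col t} : v ∈ adjoin S w ↔ v ∈ S ∨ v + w ∈ S := by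
  simp only [adjoin, Finset.mem_union, Finset.mem_image]
  constructor
  · rintro (h | ⟨s, hs, rfl⟩)
    · exact Or.inl h
    · right
      rwa [Col.add_add_cancel_right]
  · rintro (h | h)
    · exact Or.inl h
    · exact Or.inr ⟨v + w, h, Col.add_add_cancel_right v w⟩

/-- Auxiliary (theorem `subset_adjoin`): subset adjoin. [folklore] -/
theorem subset_adjoin (S : Finset (Col t)) (w : Col t) : S ⊆ adjoin S w := Finset.subset_union_left

/-- Auxiliary (theorem `mem_adjoin_self`): mem adjoin self. [folklore] -/
theorem mem_adjoin_self {S : Finset (Col t)} (hS : IsSub S) (w : Col t) : w ∈ adjoin S w :=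
  mem_adjoin.2 (Or.inr (by rw [Col.add_self]; exact hS.zero_mem))

/-- Auxiliary (theorem `isSub_adjoin`): isSub adjoin. [folklore] -/
theorem isSub_adjoin {S : Finset (Col t)} (hS : IsSub S) (w : Col t) : IsSub (adjoin S w) := by
  refine ⟨subset_adjoin S w hS.zero_mem, fun a ha b hb => ?_⟩
  rw [mem_adjoin] at ha hb ⊢
  rcases ha with ha | ha <;> rcases hb with hb | hb
  · exact Or.inl (hS.add_mem _ ha _ hb)
  · right
    rw [add_assoc]
    exact hS.add_mem _ ha _ hb
  · right
    rw [add_assoc, add_comm b w, ← add_assoc]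
    exact hS.add_mem _ ha _ hb
  · left
    have := hS.add_mem _ ha _ hb
    rwa [add_assoc, add_comm w (b + w), Col.add_add_cancel_right] at this

/-- Auxiliary (theorem `adjoin_subset`): adjoin subset. [folklore] -/
theorem adjoin_subset {S T : Finset (Col t)} (hT : IsSub T) (hST : S ⊆ T) {w : Col t} (hw : w ∈ T) :
    adjoin S w ⊆ T := by
  intro v hv
  rcases mem_adjoin.1 hv with h | h
  · exact hST h
  · have := hT.add_mem _ (hST h) _ hw
    rwa [Col.add_add_cancel_right] at this

/-- Auxiliary (theorem `card_adjoin`): card adjoin. [folklore] -/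
theorem card_adjoin {S : Finset (Col t)} (hS : IsSub S) {w : Col t} (hw : w ∉ S) :
    (adjoin S w).card = 2 * S.card := by
  rw [adjoin, Finset.card_union_of_disjoint, Finset.card_image_of_injective _ (add_left_injective w),
    two_mul]
  rw [Finset.disjoint_left]
  rintro v hv hv'
  obtain ⟨s, hs, rfl⟩ := Finset.mem_image.1 hv'
  have := hS.add_mem _ hs _ hv
  rw [Col.add_add_cancel_left] at this
  exact hw this

/-- Auxiliary (theorem `iso_adjoin`): iso adjoin. [folklore] -/
theorem iso_adjoin {S : Finset (Col t)} (hiso : ∀ v ∈ S, qchar v = 1) {w : Col t}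
    (hw : w ∈ perp S) (hqw : qchar w = 1) : ∀ v ∈ adjoin S w, qchar v = 1 := by
  intro v hv
  rcases mem_adjoin.1 hv with h | h
  · exact hiso v h
  · have e : v = (v + w) + w := (Col.add_add_cancel_right v w).symm
    rw [e, qchar_add, hiso _ h, hqw, mem_perp.1 hw _ h]
    simp

/-! ### Counting stochastic Lagrangian subspaces -/

/-- `Σ_{t,t}(2)` in the language of this file: subgroups `T ⊆ 𝔽₂^{2t}` with `|T| = 2^t`, `1 ∈ T`,
totally `𝔮`-isotropic (equivalent to `IsStochasticLagrangian`, see `isStochasticLagrangian_iff_isLagr`).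
[cite: GrossNezamiWalter2021, Def. 4.1] -/
structure IsLagr (T : Finset (Col t)) : Prop where
  card_eq : T.card = 2 ^ t
  one_mem : (1 : Col t) ∈ T
  isSub : IsSub T
  iso : ∀ v ∈ T, qchar v = 1

open scoped Classical in
/-- The stochastic Lagrangian subspaces containing a given finset `S`. [folklore] -/
def lagrAbove (S : Finset (Col t)) : Finset (Finset (Col t)) :=
  Finset.univ.filter fun T => IsLagr T ∧ S ⊆ T

/-- Auxiliary (theorem `mem_lagrAbove`): mem lagrAbove. [folklore] -/
theorem mem_lagrAbove {S T : Finset (Col t)} : T ∈ lagrAbove S ↔ IsLagr T ∧ S ⊆ T := by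
  simp [lagrAbove]

/-- Auxiliary (theorem `lagrAbove_filter_mem`): lagrAbove filter mem. [folklore] -/
theorem lagrAbove_filter_mem {S : Finset (Col t)} (hS : IsSub S) (w : Col t) :
    (lagrAbove S).filter (fun T => w ∈ T) = lagrAbove (adjoin S w) := by
  ext T
  simp only [Finset.mem_filter, mem_lagrAbove]
  constructor
  · rintro ⟨⟨hT, hST⟩, hw⟩
    exact ⟨hT, adjoin_subset hT.isSub hST hw⟩
  · rintro ⟨hT, hST⟩
    exact ⟨⟨hT, (subset_adjoin S w).trans hST⟩, hST (mem_adjoin_self hS w)⟩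

/-- If some `T ∈ Σ_{t,t}` contains the subgroup `S` and `w`, then `w` is isotropic and orthogonal
to `S`. [folklore] -/
theorem lagrAbove_adjoin_eq_empty {S : Finset (Col t)} (hS : IsSub S) {w : Col t}
    (hw : ¬ (w ∈ perp S ∧ qchar w = 1)) : lagrAbove (adjoin S w) = ∅ := by
  rw [Finset.eq_empty_iff_forall_notMem]
  intro T hT
  rw [mem_lagrAbove] at hT
  obtain ⟨hT, hST⟩ := hT
  have hwT : w ∈ T := hST (mem_adjoin_self hS w)
  apply hw
  refine ⟨?_, hT.iso w hwT⟩
  exact perp_antitone ((subset_adjoin S w).trans hST) (subset_perp_of_iso hT.isSub hT.iso hwT)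

/-- **Counting Lagrangians above a stochastic isotropic subgroup.** If `S ∋ 1_{2t}` is a totally
isotropic subgroup with `|S| = 2^{t-j}`, then exactly `∏_{i<j} (2^i + 1)` stochastic Lagrangian
subspaces contain `S`. Proof by induction on `j`, double counting the pairs `(w, T)` with
`S ⊆ T ∈ Σ_{t,t}`, `w ∈ T ∖ S`, using `2 #{w ∈ S^⊥ isotropic} = |S^⊥| + 2^t`
(`two_mul_card_iso_perp`). This replaces the parametrisation-by-`(X, A)` count of
[GNW21, proof of Thm. 4.8] by an elementary recursion with the same outcome.
[cite: GrossNezamiWalter2021, Thm. 4.8 (arXiv numbering; Thm. 4.10 published)] -/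
theorem card_lagrAbove_aux (j : ℕ) : ∀ (_ : j ≤ t) (S : Finset (Col t)), IsSub S →
    (1 : Col t) ∈ S → (∀ v ∈ S, qchar v = 1) → S.card = 2 ^ (t - j) →
    (lagrAbove S).card = ∏ i ∈ Finset.range j, (2 ^ i + 1) := by
  induction j with
  | zero =>
    intro _ S hS h1 hiso hc
    rw [Nat.sub_zero] at hc
    rw [Finset.range_zero, Finset.prod_empty, Finset.card_eq_one]
    refine ⟨S, ?_⟩
    ext T
    rw [mem_lagrAbove, Finset.mem_singleton]
    constructor
    · rintro ⟨hT, hST⟩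
      exact (Finset.eq_of_subset_of_card_le hST (by rw [hc, hT.card_eq])).symm
    · rintro rfl
      exact ⟨⟨hc, h1, hS, hiso⟩, Finset.Subset.refl _⟩
  | succ j ih =>
    intro hj S hS h1 hiso hc
    set k := t - (j + 1) with hk
    have hkt : k + (j + 1) = t := by omega
    have hk1 : t - j = k + 1 := by omega
    set P := ∏ i ∈ Finset.range j, (2 ^ i + 1) with hP
    set Q := (perp S).filter fun w => qchar w = 1 with hQ
    have hSQ : S ⊆ Q := by
      intro s hs
      rw [hQ, Finset.mem_filter]
      exact ⟨subset_perp_of_iso hS hiso hs, hiso s hs⟩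
    have hgood : ∀ w ∈ Q, w ∉ S → (lagrAbove (adjoin S w)).card = P := by
      intro w hw hwS
      rw [hQ, Finset.mem_filter] at hw
      refine ih (by omega) (adjoin S w) (isSub_adjoin hS w) (subset_adjoin S w h1)
        (iso_adjoin hiso hw.1 hw.2) ?_
      rw [card_adjoin hS hwS, hc, hk1, pow_succ, mul_comm]
    have hbad : ∀ w, w ∉ Q → (lagrAbove (adjoin S w)).card = 0 := by
      intro w hw
      rw [lagrAbove_adjoin_eq_empty hS (by rwa [hQ, Finset.mem_filter] at hw), Finset.card_empty]
    -- double counting of `D = #{(w, T) : S ⊆ T ∈ Σ, w ∈ T ∖ S}`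
    set D := ∑ T ∈ lagrAbove S, (T \ S).card with hD
    have hD1 : D = (lagrAbove S).card * (2 ^ t - 2 ^ k) := by
      rw [hD]
      refine Finset.sum_const_nat fun T hT => ?_
      rw [mem_lagrAbove] at hT
      rw [Finset.card_sdiff_of_subset hT.2, hT.1.card_eq, hc]
    have hD2 : D = ∑ w ∈ Finset.univ.filter (fun w => w ∉ S), (lagrAbove (adjoin S w)).card := by
      have e1 : ∀ T ∈ lagrAbove S, (T \ S).card =
          ∑ w ∈ Finset.univ.filter (fun w => w ∉ S), if w ∈ T then 1 else 0 := by
        intro T _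
        rw [Finset.sum_boole, Nat.cast_id]
        congr 1
        ext w
        simp only [Finset.mem_sdiff, Finset.mem_filter, Finset.mem_univ, true_and]
        tauto
      rw [hD, Finset.sum_congr rfl e1, Finset.sum_comm]
      refine Finset.sum_congr rfl fun w _ => ?_
      rw [Finset.sum_boole, Nat.cast_id, lagrAbove_filter_mem hS w]
    have hD3 : ∑ w ∈ Finset.univ.filter (fun w => w ∉ S), (lagrAbove (adjoin S w)).card =
        (Q.card - S.card) * P := by
      rw [Finset.sum_congr rfl (g := fun w => if w ∈ Q then P else 0) ?_]
      · rw [← Finset.sum_filter, Finset.sum_const, smul_eq_mul, ← Finset.card_sdiff_of_subset hSQ]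
        congr 2
        ext w
        simp only [Finset.mem_filter, Finset.mem_univ, true_and, Finset.mem_sdiff]
        tauto
      · intro w hw
        rw [Finset.mem_filter] at hw
        split_ifs with hwQ
        · exact hgood w hwQ hw.2
        · exact hbad w hwQ
    have hR := card_perp_mul_card hS
    have h2Q := two_mul_card_iso_perp hS hiso h1
    rw [← hQ] at h2Q
    rw [hc] at hR
    have hQS : 2 ^ k ≤ Q.card := hc ▸ Finset.card_le_card hSQ
    have eq1 : (lagrAbove S).card * (2 ^ t - 2 ^ k) = (Q.card - 2 ^ k) * P := by
      rw [← hD1, hD2, hD3, hc]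
    have h2k : (2 : ℕ) ^ k ≤ 2 ^ t := Nat.pow_le_pow_right (by norm_num) (by omega)
    rw [Finset.prod_range_succ, ← hP]
    zify [h2k, hQS] at eq1
    zify at hR h2Q ⊢
    have ht : (2 : ℤ) ^ t = 2 ^ k * 2 ^ j * 2 := by
      rw [← hkt, pow_add, pow_succ]; ring
    have h4 : (4 : ℤ) ^ t = 2 ^ t * 2 ^ t := by
      rw [← mul_pow]; norm_num
    have ha : (2 : ℤ) ^ k ≠ 0 := pow_ne_zero _ two_ne_zero
    have hRval : ((perp S).card : ℤ) = 4 * 2 ^ k * (2 ^ j) ^ 2 := by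
      apply mul_right_cancel₀ ha
      rw [hR, h4, ht]
      ring
    have hQval : (Q.card : ℤ) = 2 * 2 ^ k * (2 ^ j) ^ 2 + 2 ^ k * 2 ^ j := by
      rw [hRval, ht] at h2Q
      linarith
    rw [hQval, ht] at eq1
    have hb : (1 : ℤ) ≤ 2 ^ j := one_le_pow₀ (by norm_num)
    have hc2 : (2 : ℤ) ^ k * (2 * 2 ^ j - 1) ≠ 0 := mul_ne_zero ha (by linarith)
    apply mul_right_cancel₀ hc2
    linear_combination eq1

/-- **Cardinality of `Σ_{t,t}(2)`** (all stochastic Lagrangians contain the subgroup `{0, 1_{2t}}`):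
`|Σ_{t,t}(2)| = ∏_{k=0}^{t-2} (2^k + 1)` for `t ≥ 1`.
[cite: GrossNezamiWalter2021, Thm. 4.8 (arXiv numbering; Thm. 4.10 published)] -/
theorem card_lagrAbove_pair (ht : 1 ≤ t) :
    (lagrAbove ({0, 1} : Finset (Col t))).card = ∏ i ∈ Finset.range (t - 1), (2 ^ i + 1) := by
  have h01 : (0 : Col t) ≠ 1 := by
    intro h
    have := congrFun (congrArg Prod.fst h) ⟨0, ht⟩
    simp [Col.one_eq, Col.zero_eq] at this
  refine card_lagrAbove_aux (t - 1) (Nat.sub_le t 1) {0, 1} ⟨by simp, ?_⟩ (by simp) ?_ ?_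
  · intro a ha b hb
    simp only [Finset.mem_insert, Finset.mem_singleton] at ha hb ⊢
    rcases ha with rfl | rfl <;> rcases hb with rfl | rfl <;> simp
  · intro v hv
    simp only [Finset.mem_insert, Finset.mem_singleton] at hv
    rcases hv with rfl | rfl <;> simp
  · rw [Finset.card_pair h01]
    have : t - (t - 1) = 1 := by omega
    rw [this, pow_one]

/-! ### Boolean combinations and spans of column tuples -/

section Span

variable {n : ℕ}

/-- The Boolean combination `∑_{i : cᵢ = 1} Vᵢ` of the columns `V`. [folklore] -/
def bcomb (V : Fin n → Col t) (c : Fin n → Bool) : Col t := ∑ i, if c i = true then V i else 0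

/-- The `𝔽₂`-span of the columns `V₀, …, V_{n-1}`, as a finset. [folklore] -/
def spanF (V : Fin n → Col t) : Finset (Col t) := Finset.univ.image (bcomb V)

/-- Auxiliary (theorem `bcomb_add`): bcomb add. [folklore] -/
theorem bcomb_add (V : Fin n → Col t) (c c' : Fin n → Bool) :
    bcomb V (c + c') = bcomb V c + bcomb V c' := by
  simp only [bcomb, ← Finset.sum_add_distrib]
  refine Finset.sum_congr rfl fun i _ => ?_
  simp only [Pi.add_apply]
  rcases Bool.eq_false_or_eq_true (c i) with h | h <;>
    rcases Bool.eq_false_or_eq_true (c' i) with h' | h' <;> simp [h, h', Bool.add_eq_xor]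

/-- Auxiliary (theorem `bcomb_zero`): bcomb zero. [folklore] -/
@[simp] theorem bcomb_zero (V : Fin n → Col t) : bcomb V (fun _ => false) = 0 := by simp [bcomb]

/-- Auxiliary (theorem `bcomb_single`): bcomb single. [folklore] -/
theorem bcomb_single (V : Fin n → Col t) (i : Fin n) :
    bcomb V (fun i' => decide (i' = i)) = V i := by
  simp [bcomb, Finset.sum_ite_eq']

/-- Auxiliary (theorem `bcomb_update_of_false`): bcomb update of false. [folklore] -/
theorem bcomb_update_of_false (V : Fin n → Col t) {c : Fin n → Bool} {j : Fin n} (hc : c j = false)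
    (w : Col t) : bcomb (Function.update V j w) c = bcomb V c := by
  unfold bcomb
  refine Finset.sum_congr rfl fun i _ => ?_
  by_cases hij : i = j
  · subst hij
    simp [hc]
  · rw [Function.update_of_ne hij]

/-- Auxiliary (theorem `mem_spanF`): mem spanF. [folklore] -/
theorem mem_spanF {V : Fin n → Col t} {w : Col t} : w ∈ spanF V ↔ ∃ c, bcomb V c = w := by
  simp [spanF]

/-- Auxiliary (theorem `bcomb_mem_spanF`): bcomb mem spanF. [folklore] -/
theorem bcomb_mem_spanF (V : Fin n → Col t) (c : Fin n → Bool) : bcomb V c ∈ spanF V :=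
  mem_spanF.2 ⟨c, rfl⟩

/-- Auxiliary (theorem `mem_spanF_self`): mem spanF self. [folklore] -/
theorem mem_spanF_self (V : Fin n → Col t) (i : Fin n) : V i ∈ spanF V :=
  mem_spanF.2 ⟨_, bcomb_single V i⟩

/-- Auxiliary (theorem `isSub_spanF`): isSub spanF. [folklore] -/
theorem isSub_spanF (V : Fin n → Col t) : IsSub (spanF V) := by
  refine ⟨mem_spanF.2 ⟨fun _ => false, bcomb_zero V⟩, ?_⟩
  rintro a ha b hb
  obtain ⟨c, rfl⟩ := mem_spanF.1 ha
  obtain ⟨c', rfl⟩ := mem_spanF.1 hb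
  exact mem_spanF.2 ⟨c + c', bcomb_add V c c'⟩

/-- Auxiliary (theorem `zero_mem_spanF`): zero mem spanF. [folklore] -/
theorem zero_mem_spanF (V : Fin n → Col t) : (0 : Col t) ∈ spanF V := (isSub_spanF V).zero_mem

/-- Auxiliary (theorem `bcomb_mem_of_forall`): bcomb mem of forall. [folklore] -/
theorem bcomb_mem_of_forall {S : Finset (Col t)} (hS : IsSub S) {V : Fin n → Col t}
    (hV : ∀ i, V i ∈ S) (c : Fin n → Bool) : bcomb V c ∈ S := by
  unfold bcomb
  refine Finset.sum_induction _ (· ∈ S) (fun a b ha hb => hS.add_mem a ha b hb) hS.zero_mem ?_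
  intro i _
  split_ifs
  · exact hV i
  · exact hS.zero_mem

/-- Auxiliary (theorem `spanF_subset`): spanF subset. [folklore] -/
theorem spanF_subset {S : Finset (Col t)} (hS : IsSub S) {V : Fin n → Col t} (hV : ∀ i, V i ∈ S) :
    spanF V ⊆ S := by
  intro w hw
  obtain ⟨c, rfl⟩ := mem_spanF.1 hw
  exact bcomb_mem_of_forall hS hV c

/-- Auxiliary (theorem `spanF_mono`): spanF mono. [folklore] -/
theorem spanF_mono {m : ℕ} {V : Fin n → Col t} {W : Fin m → Col t} (h : ∀ i, V i ∈ spanF W) :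
    spanF V ⊆ spanF W :=
  spanF_subset (isSub_spanF W) h

/-- Auxiliary (theorem `card_univ_fun_bool`): card univ fun bool. [folklore] -/
theorem card_univ_fun_bool : (Finset.univ : Finset (Fin n → Bool)).card = 2 ^ n := by
  rw [Finset.card_univ, Fintype.card_fun, Fintype.card_bool, Fintype.card_fin]

/-- Auxiliary (theorem `card_spanF_le`): card spanF le. [folklore] -/
theorem card_spanF_le (V : Fin n → Col t) : (spanF V).card ≤ 2 ^ n :=
  Finset.card_image_le.trans card_univ_fun_bool.le

/-- Auxiliary (theorem `injective_bcomb_of_card`): injective bcomb of card. [folklore] -/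
theorem injective_bcomb_of_card {V : Fin n → Col t} (h : (spanF V).card = 2 ^ n) :
    Function.Injective (bcomb V) := by
  have : (Finset.univ.image (bcomb V)).card = (Finset.univ : Finset (Fin n → Bool)).card := by
    rw [card_univ_fun_bool]
    exact h
  have h2 := Finset.card_image_iff.1 this
  rwa [Finset.coe_univ, Set.injOn_univ] at h2

/-- Auxiliary (theorem `exists_bcomb_eq_zero`): exists bcomb eq zero. [folklore] -/
theorem exists_bcomb_eq_zero {V : Fin n → Col t} (h : (spanF V).card < 2 ^ n) :
    ∃ c : Fin n → Bool, c ≠ (fun _ => false) ∧ bcomb V c = 0 := by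
  have hni : ¬ Function.Injective (bcomb V) := by
    intro hinj
    have := Finset.card_image_of_injective (Finset.univ : Finset (Fin n → Bool)) hinj
    rw [card_univ_fun_bool] at this
    exact h.ne this
  obtain ⟨c₁, c₂, he, hne⟩ := Function.not_injective_iff.1 hni
  refine ⟨c₁ + c₂, ?_, ?_⟩
  · intro h0
    apply hne
    funext i
    have := congrFun h0 i
    simp only [Pi.add_apply] at this
    revert this
    cases c₁ i <;> cases c₂ i <;> simp [Bool.add_eq_xor]
  · rw [bcomb_add, he, Col.add_self]

/-- Auxiliary (theorem `exists_index_of_ne`): exists index of ne. [folklore] -/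
theorem exists_index_of_ne {c : Fin n → Bool} (hc : c ≠ fun _ => false) : ∃ j, c j = true := by
  by_contra h
  push Not at h
  exact hc (funext fun j => by simpa using h j)

/-- Decomposing a combination at an index `j` with `c j = 1`. [folklore] -/
theorem bcomb_eq_add_update (V : Fin n → Col t) {c : Fin n → Bool} {j : Fin n} (hj : c j = true) :
    bcomb V c = V j + bcomb V (Function.update c j false) := by
  unfold bcomb
  rw [← Finset.add_sum_erase Finset.univ (fun i => if c i = true then V i else 0) (Finset.mem_univ j),
    ← Finset.add_sum_erase Finset.univ (fun i => if Function.update c j false i = true then V i else 0)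
      (Finset.mem_univ j), hj, if_pos rfl, Function.update_self]
  simp only [Bool.false_eq_true, if_false, zero_add]
  congr 1
  refine Finset.sum_congr rfl fun i hi => ?_
  rw [Function.update_of_ne (Finset.ne_of_mem_erase hi)]

/-- Auxiliary (theorem `spanF_update_eq`): spanF update eq. [folklore] -/
theorem spanF_update_eq {V : Fin n → Col t} {j : Fin n} {w : Col t} (hw : w ∈ spanF V)
    (hj : V j ∈ spanF (Function.update V j w)) : spanF (Function.update V j w) = spanF V := by
  apply Finset.Subset.antisymm
  · apply spanF_mono
    intro i
    by_cases hij : i = j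
    · subst hij
      simpa using hw
    · rw [Function.update_of_ne hij]
      exact mem_spanF_self V i
  · apply spanF_mono
    intro i
    by_cases hij : i = j
    · subst hij
      exact hj
    · rw [← Function.update_of_ne hij w V]
      exact mem_spanF_self _ i

/-- Auxiliary (theorem `spanF_comp_equiv`): spanF comp equiv. [folklore] -/
theorem spanF_comp_equiv (V : Fin n → Col t) (σ : Equiv.Perm (Fin n)) : spanF (V ∘ σ) = spanF V := by
  apply Finset.Subset.antisymm
  · exact spanF_mono fun i => mem_spanF_self V (σ i)
  · apply spanF_mono
    intro i
    have := mem_spanF_self (V ∘ σ) (σ.symm i)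
    simpa using this

/-- Auxiliary (theorem `bcomb_snoc`): bcomb snoc. [folklore] -/
theorem bcomb_snoc {m : ℕ} (U : Fin m → Col t) (v : Col t) (d : Fin (m + 1) → Bool) :
    bcomb (Fin.snoc U v : Fin (m + 1) → Col t) d =
      bcomb U (Fin.init d) + if d (Fin.last m) = true then v else 0 := by
  unfold bcomb
  rw [Fin.sum_univ_castSucc]
  simp only [Fin.snoc_castSucc, Fin.snoc_last]
  rfl

/-- Auxiliary (theorem `spanF_snoc`): spanF snoc. [folklore] -/
theorem spanF_snoc {m : ℕ} (U : Fin m → Col t) (v : Col t) :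
    spanF (Fin.snoc U v : Fin (m + 1) → Col t) = adjoin (spanF U) v := by
  ext w
  rw [mem_spanF, mem_adjoin, mem_spanF, mem_spanF]
  constructor
  · rintro ⟨d, rfl⟩
    rw [bcomb_snoc]
    by_cases hd : d (Fin.last m) = true
    · right
      rw [if_pos hd, Col.add_add_cancel_right]
      exact ⟨_, rfl⟩
    · left
      rw [if_neg hd, add_zero]
      exact ⟨_, rfl⟩
  · rintro (⟨c, rfl⟩ | ⟨c, hc⟩)
    · refine ⟨Fin.snoc c false, ?_⟩
      rw [bcomb_snoc]
      simp
    · refine ⟨Fin.snoc c true, ?_⟩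
      rw [bcomb_snoc]
      simp only [Fin.init_snoc, Fin.snoc_last, if_true]
      rw [hc, Col.add_add_cancel_right]

/-- Auxiliary (theorem `spanF_snoc_zero`): spanF snoc zero. [folklore] -/
theorem spanF_snoc_zero {m : ℕ} (U : Fin m → Col t) :
    spanF (Fin.snoc U 0 : Fin (m + 1) → Col t) = spanF U := by
  rw [spanF_snoc]
  ext w
  rw [mem_adjoin, add_zero, or_self]

/-- A subgroup of cardinality `2^m` is generated by `m` vectors. [folklore] -/
theorem exists_spanF_eq {S : Finset (Col t)} (hS : IsSub S) :
    ∀ (m : ℕ), S.card = 2 ^ m → ∃ b : Fin m → Col t, spanF b = S := by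
  suffices h : ∀ k : ℕ, 2 ^ k ≤ S.card → ∃ b : Fin k → Col t, spanF b ⊆ S ∧ (spanF b).card = 2 ^ k by
    intro m hm
    obtain ⟨b, hb, hc⟩ := h m hm.ge
    exact ⟨b, Finset.eq_of_subset_of_card_le hb (by rw [hc, hm])⟩
  intro k
  induction k with
  | zero =>
    intro _
    refine ⟨Fin.elim0, spanF_subset hS fun i => i.elim0, ?_⟩
    rw [pow_zero, Finset.card_eq_one]
    refine ⟨0, ?_⟩
    ext w
    rw [mem_spanF, Finset.mem_singleton]
    constructor
    · rintro ⟨c, rfl⟩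
      simp [bcomb]
    · rintro rfl
      exact ⟨fun _ => false, bcomb_zero _⟩
  | succ k ih =>
    intro hk
    obtain ⟨b, hb, hc⟩ := ih ((Nat.pow_le_pow_right (by norm_num) k.le_succ).trans hk)
    have hlt : (spanF b).card < S.card := by
      rw [hc]; exact lt_of_lt_of_le (Nat.pow_lt_pow_right (by norm_num) k.lt_succ_self) hk
    obtain ⟨v, hvS, hvb⟩ := Finset.exists_mem_notMem_of_card_lt_card hlt
    refine ⟨Fin.snoc b v, ?_, ?_⟩
    · rw [spanF_snoc]
      exact adjoin_subset hS hb hvS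
    · rw [spanF_snoc, card_adjoin (isSub_spanF b) hvb, hc, pow_succ, mul_comm]

end Span

/-! ### Column operations: functions invariant under `Vⱼ ↦ Vⱼ + Vᵢ` -/

section ColOps

variable {n : ℕ}

/-- Invariance of `f` under the elementary column additions `Vⱼ ↦ Vⱼ + Vᵢ` (`i ≠ j`), the action of
`CNOT_{i → j}^{⊗ 2t}` on matrix entries. [folklore] -/
structure IsColAddInv (f : (Fin n → Col t) → ℂ) : Prop where
  colAdd : ∀ (V : Fin n → Col t) (i j : Fin n), i ≠ j → f (Function.update V j (V j + V i)) = f V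

variable {f : (Fin n → Col t) → ℂ}

/-- Adding any combination of the other columns to column `j` leaves `f` invariant. [folklore] -/
theorem IsColAddInv.update_add_bcomb (hf : IsColAddInv f) (V : Fin n → Col t) (j : Fin n)
    (c : Fin n → Bool) (hc : c j = false) :
    f (Function.update V j (V j + bcomb V c)) = f V := by
  suffices h : ∀ (s : Finset (Fin n)), j ∉ s → ∀ V : Fin n → Col t,
      f (Function.update V j (V j + ∑ i ∈ s, if c i = true then V i else 0)) = f V by
    have := h (Finset.univ.erase j) (Finset.notMem_erase j _) V
    rwa [bcomb, ← Finset.add_sum_erase Finset.univ (fun i => if c i = true then V i else 0)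
      (Finset.mem_univ j), hc, if_neg (by simp), zero_add]
  intro s
  induction s using Finset.induction_on with
  | empty =>
    intro _ V
    simp
  | insert a s ha ih =>
    intro hj V
    rw [Finset.mem_insert, not_or] at hj
    rw [Finset.sum_insert ha]
    set V₁ := Function.update V j (V j + if c a = true then V a else 0) with hV₁
    have h1 : f V₁ = f V := by
      by_cases hca : c a = true
      · rw [hV₁, if_pos hca]
        exact hf.colAdd V a j (fun h => hj.1 h.symm)
      · rw [hV₁, if_neg hca, add_zero, Function.update_eq_self]
    have hsum : (∑ i ∈ s, if c i = true then V₁ i else 0) = ∑ i ∈ s, if c i = true then V i else 0 := by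
      refine Finset.sum_congr rfl fun i hi => ?_
      rw [hV₁, Function.update_of_ne (show i ≠ j by rintro rfl; exact hj.2 hi)]
    have h2 : Function.update V j (V j + ((if c a = true then V a else 0) +
          ∑ i ∈ s, if c i = true then V i else 0)) =
        Function.update V₁ j (V₁ j + ∑ i ∈ s, if c i = true then V₁ i else 0) := by
      rw [hsum, hV₁, Function.update_idem, Function.update_self, add_assoc]
    rw [h2, ih hj.2 V₁, h1]

/-- Swapping two columns leaves `f` invariant (three column additions). [folklore] -/
theorem IsColAddInv.comp_swap (hf : IsColAddInv f) (V : Fin n → Col t) {i j : Fin n} (hij : i ≠ j) :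
    f (V ∘ Equiv.swap i j) = f V := by
  set V₁ := Function.update V j (V j + V i) with hV₁
  set V₂ := Function.update V₁ i (V₁ i + V₁ j) with hV₂
  set V₃ := Function.update V₂ j (V₂ j + V₂ i) with hV₃
  have hV₁i : V₁ i = V i := by rw [hV₁, Function.update_of_ne hij]
  have hV₁j : V₁ j = V j + V i := by rw [hV₁, Function.update_self]
  have hV₂i : V₂ i = V j := by
    rw [hV₂, Function.update_self, hV₁i, hV₁j, add_comm (V j), Col.add_add_cancel_left]
  have hV₂j : V₂ j = V j + V i := by rw [hV₂, Function.update_of_ne hij.symm, hV₁j]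
  have e : V ∘ Equiv.swap i j = V₃ := by
    funext k
    simp only [Function.comp_apply]
    by_cases hkj : k = j
    · subst hkj
      rw [Equiv.swap_apply_right, hV₃, Function.update_self, hV₂j, hV₂i, add_comm (V k),
        Col.add_add_cancel_right]
    · rw [hV₃, Function.update_of_ne hkj]
      by_cases hki : k = i
      · subst hki
        rw [Equiv.swap_apply_left, hV₂i]
      · rw [Equiv.swap_apply_of_ne_of_ne hki hkj, hV₂, Function.update_of_ne hki, hV₁,
          Function.update_of_ne hkj]
  rw [e, hV₃, hf.colAdd V₂ i j hij, hV₂, hf.colAdd V₁ j i hij.symm, hV₁, hf.colAdd V i j hij]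

/-- Fixing the last column: invariance descends to the first `m` columns. [folklore] -/
theorem IsColAddInv.snoc {m : ℕ} {f : (Fin (m + 1) → Col t) → ℂ} (hf : IsColAddInv f) (v : Col t) :
    IsColAddInv (fun W : Fin m → Col t => f (Fin.snoc W v)) := by
  refine ⟨fun W i j hij => ?_⟩
  show f (Fin.snoc (Function.update W j (W j + W i)) v) = f (Fin.snoc W v)
  rw [Fin.snoc_update]
  have := hf.colAdd (Fin.snoc W v) i.castSucc j.castSucc (fun h => hij (Fin.castSucc_injective _ h))
  simpa only [Fin.snoc_castSucc] using this

/-- Adding the last column to a set of earlier columns leaves `f` invariant. [folklore] -/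
theorem IsColAddInv.snoc_add_last {m : ℕ} {f : (Fin (m + 1) → Col t) → ℂ} (hf : IsColAddInv f)
    (v : Col t) (s : Finset (Fin m)) :
    ∀ U : Fin m → Col t,
      f (Fin.snoc (fun i => if i ∈ s then U i + v else U i) v) = f (Fin.snoc U v) := by
  induction s using Finset.induction_on with
  | empty => intro U; simp
  | insert a s ha ih =>
    intro U
    set U₁ := Function.update U a (U a + v) with hU₁
    have e : (fun i => if i ∈ insert a s then U i + v else U i) =
        fun i => if i ∈ s then U₁ i + v else U₁ i := by
      funext i
      by_cases hia : i = a
      · subst hia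
        rw [if_pos (Finset.mem_insert_self _ _), if_neg ha, hU₁, Function.update_self]
      · rw [hU₁, Function.update_of_ne hia]
        simp [Finset.mem_insert, hia]
    rw [e, ih U₁, hU₁, Fin.snoc_update]
    have := hf.colAdd (Fin.snoc U v) (Fin.last m) a.castSucc (Fin.castSucc_lt_last a).ne'
    simpa only [Fin.snoc_castSucc, Fin.snoc_last] using this

/-- Moving the combination `∑_{cᵢ=1} Vᵢ` (with `c_j = 1`) into column `j` by column additions:
`f` and the span are unchanged. [folklore] -/
theorem IsColAddInv.update_bcomb (hf : IsColAddInv f) (V : Fin n → Col t) {c : Fin n → Bool}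
    {j : Fin n} (hj : c j = true) :
    f (Function.update V j (bcomb V c)) = f V ∧
      spanF (Function.update V j (bcomb V c)) = spanF V := by
  set c' := Function.update c j false with hc'
  have hc'j : c' j = false := by rw [hc', Function.update_self]
  have hdec : bcomb V c = V j + bcomb V c' := bcomb_eq_add_update V hj
  rw [hdec]
  refine ⟨hf.update_add_bcomb V j c' hc'j, ?_⟩
  apply spanF_update_eq
  · exact (isSub_spanF V).add_mem _ (mem_spanF_self V j) _ (bcomb_mem_spanF V c')
  · have e : V j = (V j + bcomb V c') + bcomb (Function.update V j (V j + bcomb V c')) c' := by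
      rw [bcomb_update_of_false V hc'j, Col.add_add_cancel_right]
    generalize hV₁ : Function.update V j (V j + bcomb V c') = V₁ at e ⊢
    have hV₁j : V₁ j = V j + bcomb V c' := by rw [← hV₁, Function.update_self]
    rw [e, ← hV₁j]
    exact (isSub_spanF V₁).add_mem _ (mem_spanF_self V₁ j) _ (bcomb_mem_spanF V₁ c')

/-- Moving column `j` to the last position. [folklore] -/
theorem IsColAddInv.exists_snoc_of_update {m : ℕ} {f : (Fin (m + 1) → Col t) → ℂ}
    (hf : IsColAddInv f) (V : Fin (m + 1) → Col t) (j : Fin (m + 1)) (w : Col t) :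
    ∃ U : Fin m → Col t, f (Fin.snoc U w) = f (Function.update V j w) ∧
      spanF (Fin.snoc U w : Fin (m + 1) → Col t) = spanF (Function.update V j w) := by
  set V₁ := Function.update V j w with hV₁
  set V₂ := V₁ ∘ Equiv.swap j (Fin.last m) with hV₂
  have hf₂ : f V₂ = f V₁ := by
    by_cases hjl : j = Fin.last m
    · rw [hV₂, hjl, Equiv.swap_self]; rfl
    · exact hf.comp_swap V₁ hjl
  have hsp₂ : spanF V₂ = spanF V₁ := spanF_comp_equiv V₁ _
  have hV₂l : V₂ (Fin.last m) = w := by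
    simp only [hV₂, Function.comp_apply, Equiv.swap_apply_right, hV₁, Function.update_self]
  refine ⟨Fin.init V₂, ?_, ?_⟩
  · rw [← hf₂, ← hV₂l, Fin.snoc_init_self]
  · rw [← hsp₂, ← hV₂l, Fin.snoc_init_self]

/-- A column tuple with dependent columns can be brought, by column operations, to a tuple with
last column `0` and the same span. [folklore] -/
theorem IsColAddInv.exists_snoc_zero {m : ℕ} {f : (Fin (m + 1) → Col t) → ℂ} (hf : IsColAddInv f)
    (V : Fin (m + 1) → Col t) (hV : (spanF V).card < 2 ^ (m + 1)) :
    ∃ U : Fin m → Col t, f (Fin.snoc U 0) = f V ∧ spanF U = spanF V := by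
  obtain ⟨c, hc, hc0⟩ := exists_bcomb_eq_zero hV
  obtain ⟨j, hj⟩ := exists_index_of_ne hc
  obtain ⟨hf₁, hsp₁⟩ := hf.update_bcomb V hj
  rw [hc0] at hf₁ hsp₁
  obtain ⟨U, hfU, hspU⟩ := hf.exists_snoc_of_update V j 0
  refine ⟨U, hfU.trans hf₁, ?_⟩
  rw [← hsp₁, ← hspU, spanF_snoc_zero]

/-- **Column operations act transitively on tuples with a given span**: a function of `n` columns
that is invariant under the elementary column additions depends only on the span of the columns
(over `𝔽₂`, the elementary additions generate `GL_n(𝔽₂)`, which acts transitively on the tuples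
spanning a given subspace). [folklore] -/
theorem IsColAddInv.eq_of_spanF_eq : ∀ {n : ℕ} {f : (Fin n → Col t) → ℂ} (_ : IsColAddInv f)
    (V V' : Fin n → Col t), spanF V = spanF V' → f V = f V'
  | 0, f, _, V, V', _ => by rw [Subsingleton.elim V V']
  | m + 1, f, hf, V, V', hVV' => by
    by_cases hdep : (spanF V).card < 2 ^ (m + 1)
    · -- dependent columns: reduce both to a zero last column
      obtain ⟨U, hfU, hU⟩ := hf.exists_snoc_zero V hdep
      obtain ⟨U', hfU', hU'⟩ := hf.exists_snoc_zero V' (hVV' ▸ hdep)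
      rw [← hfU, ← hfU']
      exact (hf.snoc 0).eq_of_spanF_eq U U' (by rw [hU, hU', hVV'])
    · -- independent columns
      have hcard : (spanF V).card = 2 ^ (m + 1) := le_antisymm (card_spanF_le V) (not_lt.1 hdep)
      have hcard' : (spanF V').card = 2 ^ (m + 1) := hVV' ▸ hcard
      have hinj' := injective_bcomb_of_card hcard'
      set v := V' (Fin.last m) with hv
      set U' := Fin.init V' with hU'
      have hV' : V' = Fin.snoc U' v := by rw [hU', hv, Fin.snoc_init_self]
      -- bring `v` into the last column of `V`
      have hvV : v ∈ spanF V := hVV' ▸ mem_spanF_self V' (Fin.last m)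
      obtain ⟨c, hc⟩ := mem_spanF.1 hvV
      have hc0 : c ≠ fun _ => false := by
        rintro rfl
        rw [bcomb_zero] at hc
        have h1 : bcomb V' (fun i => decide (i = Fin.last m)) = bcomb V' (fun _ => false) := by
          rw [bcomb_single, bcomb_zero, ← hv, ← hc]
        have := congrFun (hinj' h1) (Fin.last m)
        simp at this
      obtain ⟨j, hj⟩ := exists_index_of_ne hc0
      obtain ⟨hf₁, hsp₁⟩ := hf.update_bcomb V hj
      rw [hc] at hf₁ hsp₁
      obtain ⟨U, hf₂, hsp₂⟩ := hf.exists_snoc_of_update V j v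
      -- decompose the columns of `U` along `span U' ⊕ 𝔽₂ v`
      have hspU : spanF (Fin.snoc U v : Fin (m + 1) → Col t) =
          spanF (Fin.snoc U' v : Fin (m + 1) → Col t) := by
        rw [hsp₂, hsp₁, hVV', hV']
      have hdecomp : ∀ i : Fin m, ∃ ε : Bool, U i + (if ε = true then v else 0) ∈ spanF U' := by
        intro i
        have hi : U i ∈ spanF (Fin.snoc U' v : Fin (m + 1) → Col t) := by
          rw [← hspU]
          have := mem_spanF_self (Fin.snoc U v : Fin (m + 1) → Col t) i.castSucc
          rwa [Fin.snoc_castSucc] at this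
        rw [spanF_snoc, mem_adjoin] at hi
        rcases hi with hi | hi
        · exact ⟨false, by simpa using hi⟩
        · exact ⟨true, by simpa using hi⟩
      choose ε hε using hdecomp
      set s : Finset (Fin m) := Finset.univ.filter fun i => ε i = true with hs
      set W : Fin m → Col t := fun i => if i ∈ s then U i + v else U i with hW
      have hWi : ∀ i, W i = U i + if ε i = true then v else 0 := by
        intro i
        rw [hW]
        dsimp only
        by_cases h : ε i = true
        · rw [if_pos (by simp [hs, h]), if_pos h]
        · rw [if_neg (by simp [hs, h]), if_neg h, add_zero]
      have hWmem : ∀ i, W i ∈ spanF U' := fun i => (hWi i).symm ▸ hε i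
      have hfW : f (Fin.snoc W v) = f (Fin.snoc U v) := hf.snoc_add_last v s U
      have hWU' : spanF W ⊆ spanF U' := spanF_subset (isSub_spanF U') hWmem
      have hUW : ∀ i, U i ∈ spanF (Fin.snoc W v : Fin (m + 1) → Col t) := by
        intro i
        rw [spanF_snoc, mem_adjoin]
        by_cases h : ε i = true
        · right
          have : W i = U i + v := by rw [hWi i, if_pos h]
          rw [← this]
          exact mem_spanF_self W i
        · left
          have : W i = U i := by rw [hWi i, if_neg h, add_zero]
          rw [← this]
          exact mem_spanF_self W i
      have hsnocW : spanF (Fin.snoc U v : Fin (m + 1) → Col t) ⊆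
          spanF (Fin.snoc W v : Fin (m + 1) → Col t) := by
        apply spanF_mono
        intro i
        refine Fin.lastCases ?_ (fun i => ?_) i
        · rw [Fin.snoc_last]
          have := mem_spanF_self (Fin.snoc W v : Fin (m + 1) → Col t) (Fin.last m)
          rwa [Fin.snoc_last] at this
        · rw [Fin.snoc_castSucc]
          exact hUW i
      have hcardW : 2 ^ (m + 1) ≤ 2 * (spanF W).card := by
        calc 2 ^ (m + 1) = (spanF (Fin.snoc U v : Fin (m + 1) → Col t)).card := by
              rw [hspU, ← hV', hcard']
          _ ≤ (spanF (Fin.snoc W v : Fin (m + 1) → Col t)).card := Finset.card_le_card hsnocW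
          _ = (spanF W ∪ (spanF W).image (· + v)).card := by rw [spanF_snoc]; rfl
          _ ≤ (spanF W).card + ((spanF W).image (· + v)).card := Finset.card_union_le _ _
          _ = 2 * (spanF W).card := by
              rw [Finset.card_image_of_injective _ (add_left_injective v)]; ring
      have hWeq : spanF W = spanF U' := by
        apply Finset.eq_of_subset_of_card_le hWU'
        have h1 := card_spanF_le U'
        rw [pow_succ] at hcardW
        linarith
      -- conclude
      rw [← hf₁, ← hf₂, ← hfW, hV']
      exact (hf.snoc v).eq_of_spanF_eq W U' hWeq

end ColOps

/-! ### Small helpers -/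

/-- `1_{2t} ≠ 0` for `t ≥ 1`. [folklore] -/
theorem one_ne_zero_col (ht : 1 ≤ t) : (1 : Col t) ≠ 0 := by
  intro h
  have := congrFun (congrArg Prod.fst h) ⟨0, ht⟩
  simp [Col.one_eq, Col.zero_eq] at this

/-- Auxiliary (theorem `spanF_fin_zero`): spanF fin zero. [folklore] -/
theorem spanF_fin_zero (b : Fin 0 → Col t) : spanF b = {0} := by
  ext w
  rw [mem_spanF, Finset.mem_singleton]
  constructor
  · rintro ⟨c, rfl⟩
    simp [bcomb]
  · rintro rfl
    exact ⟨fun _ => false, bcomb_zero _⟩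

/-- Auxiliary (theorem `adjoin_eq_self_of_mem`): adjoin eq self of mem. [folklore] -/
theorem adjoin_eq_self_of_mem {S : Finset (Col t)} (hS : IsSub S) {w : Col t} (hw : w ∈ S) :
    adjoin S w = S := by
  ext v
  rw [mem_adjoin]
  constructor
  · rintro (h | h)
    · exact h
    · have := hS.add_mem _ h _ hw
      rwa [Col.add_add_cancel_right] at this
  · exact fun h => Or.inl h

/-! ### Generators of a stochastic Lagrangian and the reference column tuples -/

section Gen

/-- A stochastic Lagrangian `T` has `t - 1` vectors `g₁, …, g_{t-1}` spanning a complement of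
`𝔽₂ 1_{2t}` in `T` (so that `(g₁, …, g_{t-1}, 1_{2t})` is a basis of `T`).
[cite: GrossNezamiWalter2021, proof of Lem. 4.5 (basis 1_{2t}, v₁, …, v_{t-1} of T)] -/
theorem IsLagr.exists_gen {T : Finset (Col t)} (hT : IsLagr T) (ht : 1 ≤ t) :
    ∃ g : Fin (t - 1) → Col t, (∀ i, g i ∈ T) ∧ (1 : Col t) ∉ spanF g ∧ adjoin (spanF g) 1 = T := by
  suffices h : ∀ k, k + 1 ≤ t →
      ∃ b : Fin k → Col t, spanF b ⊆ T ∧ (spanF b).card = 2 ^ k ∧ (1 : Col t) ∉ spanF b by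
    obtain ⟨g, hgT, hgc, hg1⟩ := h (t - 1) (by omega)
    refine ⟨g, fun i => hgT (mem_spanF_self g i), hg1, ?_⟩
    apply Finset.eq_of_subset_of_card_le (adjoin_subset hT.isSub hgT hT.one_mem)
    rw [card_adjoin (isSub_spanF g) hg1, hgc, hT.card_eq, ← pow_succ', Nat.sub_add_cancel ht]
  intro k
  induction k with
  | zero =>
    intro _
    refine ⟨Fin.elim0, spanF_subset hT.isSub fun i => i.elim0, ?_, ?_⟩
    · rw [spanF_fin_zero, Finset.card_singleton, pow_zero]
    · rw [spanF_fin_zero, Finset.mem_singleton]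
      exact one_ne_zero_col ht
  | succ k ih =>
    intro hk
    obtain ⟨b, hbT, hbc, hb1⟩ := ih (by omega)
    have hlt : (adjoin (spanF b) 1).card < T.card := by
      rw [card_adjoin (isSub_spanF b) hb1, hbc, hT.card_eq, ← pow_succ']
      exact Nat.pow_lt_pow_right (by norm_num) (by omega)
    obtain ⟨v, hvT, hvb⟩ := Finset.exists_mem_notMem_of_card_lt_card hlt
    have hvb' : v ∉ spanF b := fun h => hvb (subset_adjoin _ _ h)
    refine ⟨Fin.snoc b v, ?_, ?_, ?_⟩
    · rw [spanF_snoc]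
      exact adjoin_subset hT.isSub hbT hvT
    · rw [spanF_snoc, card_adjoin (isSub_spanF b) hvb', hbc, pow_succ, mul_comm]
    · rw [spanF_snoc, mem_adjoin, not_or]
      refine ⟨hb1, fun h => hvb ?_⟩
      rw [mem_adjoin]
      right
      rwa [add_comm] at h

/-- A choice of generators `g_T` of a complement of `1_{2t}` in `T ∈ Σ_{t,t}`. [folklore] -/
def IsLagr.gen {T : Finset (Col t)} (hT : IsLagr T) (ht : 1 ≤ t) : Fin (t - 1) → Col t :=
  Classical.choose (hT.exists_gen ht)

/-- Auxiliary (theorem `IsLagr.gen_spec`): IsLagr.gen spec. [folklore] -/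
theorem IsLagr.gen_spec {T : Finset (Col t)} (hT : IsLagr T) (ht : 1 ≤ t) :
    (∀ i, hT.gen ht i ∈ T) ∧ (1 : Col t) ∉ spanF (hT.gen ht) ∧ adjoin (spanF (hT.gen ht)) 1 = T :=
  Classical.choose_spec (hT.exists_gen ht)

/-- Auxiliary (theorem `IsLagr.card_spanF_gen`): IsLagr.card spanF gen. [folklore] -/
theorem IsLagr.card_spanF_gen {T : Finset (Col t)} (hT : IsLagr T) (ht : 1 ≤ t) :
    (spanF (hT.gen ht)).card = 2 ^ (t - 1) := by
  obtain ⟨_, hg1, hgT⟩ := hT.gen_spec ht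
  have h := card_adjoin (isSub_spanF (hT.gen ht)) hg1
  rw [hgT, hT.card_eq] at h
  have e : 2 ^ t = 2 * 2 ^ (t - 1) := by rw [← pow_succ', Nat.sub_add_cancel ht]
  rw [e] at h
  exact (Nat.eq_of_mul_eq_mul_left (by norm_num) h).symm

variable {n : ℕ}

/-- The reference column tuple `(g₁, …, g_k, 1_{2t}, 0, …, 0)` (truncated to `n` columns) built
from `k` generators. [cite: GrossNezamiWalter2021, proof of Lem. 4.5 (the vector v₁⊗⋯⊗v_{t-1}⊗0^{n-t+1})] -/
def refCols {k : ℕ} (g : Fin k → Col t) (n : ℕ) : Fin n → Col t :=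
  fun i => if h : (i : ℕ) < k then g ⟨i, h⟩ else if (i : ℕ) = k then 1 else 0

/-- Auxiliary (theorem `refCols_mem`): refCols mem. [folklore] -/
theorem refCols_mem {k : ℕ} {g : Fin k → Col t} {T : Finset (Col t)} (hT : IsSub T) (h1 : (1 : Col t) ∈ T)
    (hg : ∀ i, g i ∈ T) (i : Fin n) : refCols g n i ∈ T := by
  unfold refCols
  split_ifs
  · exact hg _
  · exact h1
  · exact hT.zero_mem

/-- Auxiliary (theorem `spanF_refCols_of_le`): spanF refCols of le. [folklore] -/
theorem spanF_refCols_of_le {k : ℕ} (g : Fin k → Col t) (hk : k + 1 ≤ n) :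
    spanF (refCols g n) = adjoin (spanF g) 1 := by
  apply Finset.Subset.antisymm
  · apply spanF_subset (isSub_adjoin (isSub_spanF g) 1)
    intro i
    unfold refCols
    split_ifs
    · exact subset_adjoin _ _ (mem_spanF_self g _)
    · exact mem_adjoin_self (isSub_spanF g) 1
    · exact (isSub_adjoin (isSub_spanF g) 1).zero_mem
  · apply adjoin_subset (isSub_spanF _)
    · apply spanF_mono
      intro i
      have e : g i = refCols g n ⟨i, by omega⟩ := by
        unfold refCols
        rw [dif_pos i.isLt]
      rw [e]
      exact mem_spanF_self _ _
    · have e : (1 : Col t) = refCols g n ⟨k, by omega⟩ := by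
        unfold refCols
        rw [dif_neg (lt_irrefl k), if_pos rfl]
      rw [e]
      exact mem_spanF_self _ _

/-- Auxiliary (theorem `spanF_refCols_of_eq`): spanF refCols of eq. [folklore] -/
theorem spanF_refCols_of_eq {k : ℕ} (g : Fin k → Col t) (hk : n = k) :
    spanF (refCols g n) = spanF g := by
  subst hk
  have e : refCols g n = g := by
    funext i
    unfold refCols
    rw [dif_pos i.isLt]
  rw [e]

end Gen

/-! ### Entry functions of operators in the commutant: the vanishing lemma -/

section Vanishing

variable {n : ℕ}

/-- The three relations satisfied by the entry function `f_A(V) = A_{x,y}` (`V` = the columns of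
`(x, y)`) of an operator `A` commuting with all `C^{⊗t}`, `C` a Clifford circuit: invariance under
column additions (`CNOT`), support on isotropic columns (phase gate `S`), and the Hadamard relation
`f(V) = 2^{-t} ∑_w (-1)^{β(V_j, w)} f(V[j ↦ w])` (`H^{⊗ 2t}` on qubit `j`).
[cite: GrossNezamiWalter2021, proof of Lem. 4.3 (action of the generators H, P, CADD)] -/
structure IsCliffInv (t n : ℕ) (f : (Fin n → Col t) → ℂ) : Prop extends IsColAddInv f where
  phase : ∀ (V : Fin n → Col t) (i : Fin n), f V ≠ 0 → qchar (V i) = 1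
  hada : ∀ (V : Fin n → Col t) (j : Fin n),
    f V = ((2 : ℂ) ^ t)⁻¹ * ∑ w : Col t, sgn (bilin (V j) w) * f (Function.update V j w)

variable {f : (Fin n → Col t) → ℂ}

/-- **Support**: if `f(V) ≠ 0` then the span of the columns of `V` is totally isotropic.
[cite: GrossNezamiWalter2021, proof of Lem. 4.3 (phase gate ⟹ total isotropy)] -/
theorem IsCliffInv.qchar_of_mem_spanF (hf : IsCliffInv t n f) {V : Fin n → Col t} (hV : f V ≠ 0)
    {w : Col t} (hw : w ∈ spanF V) : qchar w = 1 := by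
  obtain ⟨c, rfl⟩ := mem_spanF.1 hw
  by_cases hc : c = fun _ => false
  · subst hc
    rw [bcomb_zero, qchar_zero]
  · obtain ⟨j, hj⟩ := exists_index_of_ne hc
    obtain ⟨hf₁, -⟩ := hf.toIsColAddInv.update_bcomb V hj
    have := hf.phase _ j (by rwa [hf₁])
    rwa [Function.update_self] at this

/-- The Hadamard relation at the last column. [folklore] -/
theorem IsCliffInv.hada_snoc {m : ℕ} {f : (Fin (m + 1) → Col t) → ℂ} (hf : IsCliffInv t (m + 1) f)
    (U : Fin m → Col t) (v : Col t) :
    f (Fin.snoc U v) = ((2 : ℂ) ^ t)⁻¹ * ∑ w : Col t, sgn (bilin v w) * f (Fin.snoc U w) := by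
  have := hf.hada (Fin.snoc U v) (Fin.last m)
  simpa only [Fin.snoc_last, Fin.update_snoc_last] using this

/-- **Complementing a column does not change `f`**: `f(U, v + 1_{2t}) = f(U, v)` (the Hadamard
relation together with `β(1, w) = 0` for the isotropic columns `w` in the support). [folklore] -/
theorem IsCliffInv.snoc_add_one {m : ℕ} {f : (Fin (m + 1) → Col t) → ℂ} (hf : IsCliffInv t (m + 1) f)
    (U : Fin m → Col t) (v : Col t) : f (Fin.snoc U (v + 1)) = f (Fin.snoc U v) := by
  rw [hf.hada_snoc U (v + 1), hf.hada_snoc U v]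
  congr 1
  refine Finset.sum_congr rfl fun w _ => ?_
  by_cases hw : f (Fin.snoc U w) = 0
  · rw [hw, mul_zero, mul_zero]
  · have hq : qchar w = 1 := hf.qchar_of_mem_spanF hw (by
      have := mem_spanF_self (Fin.snoc U w : Fin (m + 1) → Col t) (Fin.last m)
      rwa [Fin.snoc_last] at this)
    rw [bilin_add_left, bilin_one_eq_false_of_qchar hq]
    simp [Bool.add_eq_xor]

/-- Two complements of `1_{2t}` in the same Lagrangian give the same value of `f`
(case `n = t - 1`). [folklore] -/
theorem IsCliffInv.eq_of_complements (hf : IsCliffInv t n f) (hnt : n + 1 = t) {T : Finset (Col t)}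
    (hT : IsLagr T) {S S' : Finset (Col t)} (hS : IsSub S) (hS' : IsSub S') (hST : S ⊆ T)
    (hS'T : S' ⊆ T) (h1S : (1 : Col t) ∉ S) (h1S' : (1 : Col t) ∉ S') (hcS : S.card = 2 ^ n)
    (hcS' : S'.card = 2 ^ n) {V V' : Fin n → Col t} (hV : spanF V = S) (hV' : spanF V' = S') :
    f V = f V' := by
  by_cases hSS' : S = S'
  · exact hf.toIsColAddInv.eq_of_spanF_eq V V' (by rw [hV, hV', hSS'])
  have hTS' : adjoin S' 1 = T := Finset.eq_of_subset_of_card_le (adjoin_subset hT.isSub hS'T hT.one_mem)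
      (by rw [card_adjoin hS' h1S', hcS', hT.card_eq, ← pow_succ', hnt])
  have hnot : ¬ S ⊆ S' := fun h => hSS' (Finset.eq_of_subset_of_card_le h (by rw [hcS, hcS']))
  obtain ⟨a, haS, haS'⟩ := Finset.not_subset.1 hnot
  have hkey : ∀ s ∈ S, s ∉ S' → s + 1 ∈ S' := by
    intro s hs hs'
    have : s ∈ adjoin S' 1 := by rw [hTS']; exact hST hs
    rcases mem_adjoin.1 this with h | h
    · exact absurd h hs'
    · exact h
  set S₀ := S ∩ S' with hS₀
  have hS₀sub : IsSub S₀ :=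
    ⟨Finset.mem_inter.2 ⟨hS.zero_mem, hS'.zero_mem⟩, fun x hx y hy => Finset.mem_inter.2
      ⟨hS.add_mem _ (Finset.mem_inter.1 hx).1 _ (Finset.mem_inter.1 hy).1,
        hS'.add_mem _ (Finset.mem_inter.1 hx).2 _ (Finset.mem_inter.1 hy).2⟩⟩
  have haS₀ : a ∉ S₀ := fun h => haS' (Finset.mem_inter.1 h).2
  have hSeq : adjoin S₀ a = S := by
    apply Finset.Subset.antisymm (adjoin_subset hS Finset.inter_subset_left haS)
    intro s hs
    rw [mem_adjoin]
    by_cases hs' : s ∈ S'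
    · exact Or.inl (Finset.mem_inter.2 ⟨hs, hs'⟩)
    · right
      refine Finset.mem_inter.2 ⟨hS.add_mem _ hs _ haS, ?_⟩
      have e : (s + 1) + (a + 1) = s + a := by
        rw [add_add_add_comm, Col.add_self, add_zero]
      rw [← e]
      exact hS'.add_mem _ (hkey s hs hs') _ (hkey a haS haS')
  obtain ⟨m, rfl⟩ : ∃ m, n = m + 1 := by
    cases n with
    | zero =>
      exfalso
      apply hSS'
      obtain ⟨x, hx⟩ := Finset.card_eq_one.1 hcS
      obtain ⟨x', hx'⟩ := Finset.card_eq_one.1 hcS'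
      have h0 := hS.zero_mem
      have h0' := hS'.zero_mem
      rw [hx, Finset.mem_singleton] at h0
      rw [hx', Finset.mem_singleton] at h0'
      rw [hx, hx', ← h0, ← h0']
    | succ m => exact ⟨m, rfl⟩
  have hcS₀ : S₀.card = 2 ^ m := by
    have h := card_adjoin hS₀sub haS₀
    rw [hSeq, hcS, pow_succ'] at h
    exact (Nat.eq_of_mul_eq_mul_left (by norm_num) h).symm
  have ha1S₀ : a + 1 ∉ S₀ := by
    intro h
    apply h1S
    have := hS.add_mem _ (Finset.mem_inter.1 h).1 _ haS
    rwa [add_comm a 1, Col.add_add_cancel_right] at this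
  have hS'eq : adjoin S₀ (a + 1) = S' := by
    apply Finset.eq_of_subset_of_card_le (adjoin_subset hS' Finset.inter_subset_right (hkey a haS haS'))
    rw [card_adjoin hS₀sub ha1S₀, hcS₀, hcS', pow_succ']
  obtain ⟨b, hb⟩ := exists_spanF_eq hS₀sub m hcS₀
  calc f V = f (Fin.snoc b a) :=
        hf.toIsColAddInv.eq_of_spanF_eq _ _ (by rw [hV, spanF_snoc, hb, hSeq])
    _ = f (Fin.snoc b (a + 1)) := (hf.snoc_add_one b a).symm
    _ = f V' := hf.toIsColAddInv.eq_of_spanF_eq _ _ (by rw [hV', spanF_snoc, hb, hS'eq])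

/-- Case `n = t - 1`, columns spanning a complement of `1_{2t}` in a Lagrangian: `f` vanishes there
as soon as it vanishes on the reference tuples. [folklore] -/
theorem IsCliffInv.typeB (hf : IsCliffInv t n f) (ht : 1 ≤ t) (hnt : n + 1 = t)
    (h0 : ∀ (T : Finset (Col t)) (hT : IsLagr T), f (refCols (hT.gen ht) n) = 0)
    {V : Fin n → Col t} (hc : (spanF V).card = 2 ^ n) (h1 : (1 : Col t) ∉ spanF V) : f V = 0 := by
  by_contra hV
  have hiso : ∀ w ∈ spanF V, qchar w = 1 := fun w hw => hf.qchar_of_mem_spanF hV hw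
  have h1p : (1 : Col t) ∈ perp (spanF V) :=
    mem_perp.2 fun s hs => by rw [bilin_comm]; exact bilin_one_eq_false_of_qchar (hiso s hs)
  have hT : IsLagr (adjoin (spanF V) 1) :=
    ⟨by rw [card_adjoin (isSub_spanF V) h1, hc, ← pow_succ', hnt], mem_adjoin_self (isSub_spanF V) 1,
      isSub_adjoin (isSub_spanF V) 1, iso_adjoin hiso h1p qchar_one⟩
  obtain ⟨_, hg1, hgT⟩ := hT.gen_spec ht
  have hsp : spanF (refCols (hT.gen ht) n) = spanF (hT.gen ht) := spanF_refCols_of_eq _ (by omega)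
  have hcg : (spanF (hT.gen ht)).card = 2 ^ n := by
    rw [hT.card_spanF_gen ht]
    congr 1
    omega
  have hgs : spanF (refCols (hT.gen ht) n) ⊆ adjoin (spanF V) 1 := by
    intro w hw
    rw [hsp] at hw
    have := subset_adjoin (spanF (hT.gen ht)) 1 hw
    rwa [hgT] at this
  apply hV
  calc f V = f (refCols (hT.gen ht) n) :=
        hf.eq_of_complements hnt hT (isSub_spanF V) (isSub_spanF _) (subset_adjoin _ _)
          hgs h1 (by rwa [hsp]) hc (by rw [hsp, hcg]) rfl rfl
    _ = 0 := h0 _ hT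

/-- **Vanishing lemma.** Let `t ≥ 1`, `n ≥ t - 1`, and let `f` satisfy the three Clifford relations.
If `f` vanishes on the reference tuple of every `T ∈ Σ_{t,t}(2)`, then `f = 0`. Consequently the
commutant has dimension at most `|Σ_{t,t}(2)|`. (This elementary descent replaces the Weyl-twirl /
symplectic-orbit count of [GNW21, Lem. 4.6 and Thm. 4.7]; it is in the spirit of the coding-theoretic
description of the commutant, [GNW21, Rem. 4.2 and Rem. 4.4 citing Nebe–Rains–Sloane].)
[cite: GrossNezamiWalter2021, Thm. 4.7 (arXiv numbering; Thm. 4.9 published): dim of the commutant] -/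
theorem IsCliffInv.vanishing (hf : IsCliffInv t n f) (ht : 1 ≤ t) (hn : t - 1 ≤ n)
    (h0 : ∀ (T : Finset (Col t)) (hT : IsLagr T), f (refCols (hT.gen ht) n) = 0)
    (V : Fin n → Col t) : f V = 0 := by
  classical
  by_contra hV
  obtain ⟨V₀, hV₀P, hmax⟩ := Finset.exists_max_image (Finset.univ.filter fun V => f V ≠ 0)
    (fun V => (spanF V).card) ⟨V, by simpa using hV⟩
  simp only [Finset.mem_filter, Finset.mem_univ, true_and] at hV₀P hmax
  set S := spanF V₀ with hS
  have hSsub : IsSub S := isSub_spanF V₀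
  have hiso : ∀ w ∈ S, qchar w = 1 := fun w hw => hf.qchar_of_mem_spanF hV₀P hw
  have hSt : S.card ≤ 2 ^ t := card_le_of_iso hSsub hiso
  have hSn : S.card ≤ 2 ^ n := card_spanF_le V₀
  have hSpos : 0 < S.card := Finset.card_pos.2 ⟨0, hSsub.zero_mem⟩
  have caseI : S.card = 2 ^ t → t ≤ n → False := by
    intro hc htn
    have hT : IsLagr S := ⟨hc, one_mem_of_card hSsub hiso hc, hSsub, hiso⟩
    obtain ⟨_, _, hgT⟩ := hT.gen_spec ht
    have hsp : spanF (refCols (hT.gen ht) n) = S := by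
      rw [spanF_refCols_of_le _ (by omega), hgT]
    exact hV₀P ((hf.toIsColAddInv.eq_of_spanF_eq V₀ _ hsp.symm).trans (h0 S hT))
  by_cases hdep : S.card < 2 ^ n
  · by_cases hct : S.card = 2 ^ t
    · exact caseI hct ((Nat.pow_lt_pow_iff_right (by norm_num)).1 (hct ▸ hdep)).le
    · -- descent
      have hlt : S.card < 2 ^ t := lt_of_le_of_ne hSt hct
      obtain ⟨m, rfl⟩ : ∃ m, n = m + 1 := by
        cases n with
        | zero => exfalso; rw [pow_zero] at hdep; omega
        | succ m => exact ⟨m, rfl⟩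
      obtain ⟨U, hfU, hspU⟩ := hf.toIsColAddInv.exists_snoc_zero V₀ hdep
      have hsp0 : spanF (Fin.snoc U 0 : Fin (m + 1) → Col t) = S := by rw [spanF_snoc_zero, hspU]
      have key := hf.hada_snoc U 0
      have hterm : ∀ w, sgn (bilin 0 w) * f (Fin.snoc U w) =
          if w ∈ S then f (Fin.snoc U 0) else 0 := by
        intro w
        rw [bilin_zero_left, sgn_false, one_mul]
        split_ifs with hw
        · apply hf.toIsColAddInv.eq_of_spanF_eq
          rw [spanF_snoc, hspU, adjoin_eq_self_of_mem hSsub hw, hsp0]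
        · by_contra hne
          have h1 := hmax _ hne
          rw [spanF_snoc, hspU, card_adjoin hSsub hw] at h1
          omega
      rw [Finset.sum_congr rfl fun w _ => hterm w, Finset.sum_ite_mem, Finset.univ_inter,
        Finset.sum_const, nsmul_eq_mul] at key
      have hf1 : f (Fin.snoc U 0) ≠ 0 := by rwa [hfU]
      have h2 : (2 : ℂ) ^ t * f (Fin.snoc U 0) = S.card * f (Fin.snoc U 0) := by
        conv_lhs => rw [key]
        field_simp
      have h3 : ((2 ^ t : ℕ) : ℂ) = (S.card : ℂ) := by exact_mod_cast mul_right_cancel₀ hf1 h2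
      have h4 : 2 ^ t = S.card := by exact_mod_cast h3
      omega
  · have hcn : S.card = 2 ^ n := le_antisymm hSn (not_lt.1 hdep)
    have hnt : n ≤ t := (Nat.pow_le_pow_iff_right (by norm_num)).1 (hcn ▸ hSt)
    by_cases hnt' : n = t
    · exact caseI (by rw [hcn, hnt']) hnt'.ge
    have hn1 : n + 1 = t := by omega
    by_cases h1S : (1 : Col t) ∈ S
    · -- the span contains `1`
      obtain ⟨m, rfl⟩ : ∃ m, n = m + 1 := by
        cases n with
        | zero =>
          exfalso
          rw [hS, spanF_fin_zero, Finset.mem_singleton] at h1S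
          exact one_ne_zero_col ht h1S
        | succ m => exact ⟨m, rfl⟩
      obtain ⟨c, hc⟩ := mem_spanF.1 h1S
      have hc0 : c ≠ fun _ => false := by
        rintro rfl
        rw [bcomb_zero] at hc
        exact one_ne_zero_col ht hc.symm
      obtain ⟨j, hj⟩ := exists_index_of_ne hc0
      obtain ⟨hf₁, hsp₁⟩ := hf.toIsColAddInv.update_bcomb V₀ hj
      rw [hc] at hf₁ hsp₁
      obtain ⟨U, hf₂, hsp₂⟩ := hf.toIsColAddInv.exists_snoc_of_update V₀ j 1
      have hfU : f (Fin.snoc U 1) = f V₀ := hf₂.trans hf₁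
      have hspU : spanF (Fin.snoc U 1 : Fin (m + 1) → Col t) = S := by rw [hsp₂, hsp₁]
      set S₀ := spanF U with hS₀
      have hS₀S : adjoin S₀ 1 = S := by rw [hS₀, ← spanF_snoc, hspU]
      have h1S₀ : (1 : Col t) ∉ S₀ := by
        intro h
        have e : adjoin S₀ 1 = S₀ := adjoin_eq_self_of_mem (isSub_spanF U) h
        have hle := card_spanF_le U
        rw [← hS₀, ← e, hS₀S, hcn, pow_succ] at hle
        have : 0 < 2 ^ m := by positivity
        omega
      have hcS₀ : S₀.card = 2 ^ m := by
        have h := card_adjoin (isSub_spanF U) h1S₀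
        rw [← hS₀, hS₀S, hcn, pow_succ'] at h
        exact (Nat.eq_of_mul_eq_mul_left (by norm_num) h).symm
      have hin : ∀ w ∈ S, f (Fin.snoc U w) = f (Fin.snoc U 1) := by
        intro w hw
        by_cases hw0 : w ∈ S₀
        · calc f (Fin.snoc U w) = f (Fin.snoc U 0) := hf.toIsColAddInv.eq_of_spanF_eq _ _ (by
                rw [spanF_snoc, spanF_snoc_zero, ← hS₀, adjoin_eq_self_of_mem (isSub_spanF U) hw0])
            _ = f (Fin.snoc U (0 + 1)) := (hf.snoc_add_one U 0).symm
            _ = f (Fin.snoc U 1) := by rw [zero_add]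
        · apply hf.toIsColAddInv.eq_of_spanF_eq
          rw [hspU, spanF_snoc, ← hS₀]
          apply Finset.eq_of_subset_of_card_le
            (adjoin_subset hSsub (by rw [← hS₀S]; exact subset_adjoin _ _) hw)
          rw [card_adjoin (isSub_spanF U) hw0, ← hS₀, hcS₀, hcn, pow_succ']
      have hout : ∀ w, w ∉ S → f (Fin.snoc U w) = 0 := by
        intro w hw
        have hw0 : w ∉ S₀ := fun h => hw (hS₀S ▸ subset_adjoin S₀ 1 h)
        apply hf.typeB ht hn1 h0
        · rw [spanF_snoc, ← hS₀, card_adjoin (isSub_spanF U) hw0, hcS₀, pow_succ']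
        · rw [spanF_snoc, ← hS₀, mem_adjoin, not_or]
          refine ⟨h1S₀, fun h => hw ?_⟩
          rw [← hS₀S, mem_adjoin]
          right
          rwa [add_comm] at h
      have key := hf.hada_snoc U 1
      have hterm : ∀ w, sgn (bilin 1 w) * f (Fin.snoc U w) =
          if w ∈ S then f (Fin.snoc U 1) else 0 := by
        intro w
        split_ifs with hw
        · rw [hin w hw, bilin_one_eq_false_of_qchar (hiso w hw), sgn_false, one_mul]
        · rw [hout w hw, mul_zero]
      rw [Finset.sum_congr rfl fun w _ => hterm w, Finset.sum_ite_mem, Finset.univ_inter,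
        Finset.sum_const, nsmul_eq_mul] at key
      have hf1 : f (Fin.snoc U 1) ≠ 0 := by rwa [hfU]
      have h2 : (2 : ℂ) ^ t * f (Fin.snoc U 1) = S.card * f (Fin.snoc U 1) := by
        conv_lhs => rw [key]
        field_simp
      have h3 : ((2 ^ t : ℕ) : ℂ) = (S.card : ℂ) := by exact_mod_cast mul_right_cancel₀ hf1 h2
      have h4 : 2 ^ t = S.card := by exact_mod_cast h3
      rw [hcn] at h4
      have := Nat.pow_right_injective (le_refl 2) h4
      omega
    · exact hV₀P (hf.typeB ht hn1 h0 hcn h1S)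

end Vanishing

/-! ### Registers versus column tuples; the entry function of an operator -/

section EntryFun

variable {n : ℕ}

/-- The column tuple of a pair of registers `(z, w)`: `V i = (z_{·,i}, w_{·,i})`. [folklore] -/
def colOf (z w : QReg (t * n)) : Fin n → Col t := fun i => (slices t n z i, slices t n w i)

/-- The row-index register of a column tuple. [folklore] -/
def regX (V : Fin n → Col t) : QReg (t * n) := (slices t n).symm fun i => (V i).1

/-- The column-index register of a column tuple. [folklore] -/
def regY (V : Fin n → Col t) : QReg (t * n) := (slices t n).symm fun i => (V i).2

/-- Auxiliary (theorem `slices_regX`): slices regX. [folklore] -/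
@[simp] theorem slices_regX (V : Fin n → Col t) : slices t n (regX V) = fun i => (V i).1 :=
  Equiv.apply_symm_apply _ _

/-- Auxiliary (theorem `slices_regY`): slices regY. [folklore] -/
@[simp] theorem slices_regY (V : Fin n → Col t) : slices t n (regY V) = fun i => (V i).2 :=
  Equiv.apply_symm_apply _ _

/-- Auxiliary (theorem `colOf_regX_regY`): colOf regX regY. [folklore] -/
@[simp] theorem colOf_regX_regY (V : Fin n → Col t) : colOf (regX V) (regY V) = V := by
  funext i
  show (slices t n (regX V) i, slices t n (regY V) i) = V i
  rw [slices_regX, slices_regY]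

/-- Auxiliary (theorem `regX_colOf`): regX colOf. [folklore] -/
@[simp] theorem regX_colOf (z w : QReg (t * n)) : regX (colOf z w) = z :=
  (slices t n).symm_apply_apply z

/-- Auxiliary (theorem `regY_colOf`): regY colOf. [folklore] -/
@[simp] theorem regY_colOf (z w : QReg (t * n)) : regY (colOf z w) = w :=
  (slices t n).symm_apply_apply w

/-- The entry function `f_A(V) = A_{z,w}`, `V = colOf z w`, of an operator on `QReg (t * n)`. [folklore] -/
def entryFun (A : Matrix (QReg (t * n)) (QReg (t * n)) ℂ) : (Fin n → Col t) → ℂ :=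
  fun V => A (regX V) (regY V)

/-- Auxiliary (theorem `entryFun_apply`): entryFun apply. [folklore] -/
theorem entryFun_apply (A : Matrix (QReg (t * n)) (QReg (t * n)) ℂ) (V : Fin n → Col t) :
    entryFun A V = A (regX V) (regY V) := rfl

/-- Auxiliary (theorem `entryFun_colOf`): entryFun colOf. [folklore] -/
@[simp] theorem entryFun_colOf (A : Matrix (QReg (t * n)) (QReg (t * n)) ℂ) (z w : QReg (t * n)) :
    entryFun A (colOf z w) = A z w := by
  simp [entryFun]

/-- Auxiliary (theorem `eq_of_entryFun_eq`): eq of entryFun eq. [folklore] -/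
theorem eq_of_entryFun_eq {A B : Matrix (QReg (t * n)) (QReg (t * n)) ℂ} (h : entryFun A = entryFun B) :
    A = B := by
  ext z w
  rw [← entryFun_colOf A, ← entryFun_colOf B, h]

/-- The entry function as a linear map. [folklore] -/
def entryFunₗ (t n : ℕ) : Matrix (QReg (t * n)) (QReg (t * n)) ℂ →ₗ[ℂ] ((Fin n → Col t) → ℂ) where
  toFun := entryFun
  map_add' _ _ := rfl
  map_smul' _ _ := rfl

/-- Auxiliary (theorem `entryFunₗ_apply`): entryFunₗ apply. [folklore] -/
@[simp] theorem entryFunₗ_apply (A : Matrix (QReg (t * n)) (QReg (t * n)) ℂ) :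
    entryFunₗ t n A = entryFun A := rfl

/-- Auxiliary (theorem `entryFunₗ_injective`): entryFunₗ injective. [folklore] -/
theorem entryFunₗ_injective : Function.Injective (entryFunₗ t n) := fun _ _ h =>
  eq_of_entryFun_eq h

/-- Entries of `R(T)`: `f_{R(T)}(V) = [V_i ∈ T ∀ i]`. [cite: GrossNezamiWalter2021, §4.1 (R(T) = r(T)^{⊗n})] -/
theorem entryFun_cliffordCodeOperator (T : Finset (Col t)) (n : ℕ) (V : Fin n → Col t) :
    entryFun (cliffordCodeOperator T n) V = if ∀ i, V i ∈ T then 1 else 0 := by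
  rw [entryFun_apply, cliffordCodeOperator_apply_eq_ite]
  simp only [slices_regX, slices_regY, Prod.mk.eta]

/-- Auxiliary (theorem `colOf_symm_update_left`): colOf symm update left. [folklore] -/
theorem colOf_symm_update_left (V : Fin n → Col t) (i : Fin n) (x' : QReg t) :
    colOf ((slices t n).symm (Function.update (slices t n (regX V)) i x')) (regY V) =
      Function.update V i (x', (V i).2) := by
  funext i'
  simp only [colOf, Equiv.apply_symm_apply, slices_regY, slices_regX]
  by_cases h : i' = i
  · subst h
    simp
  · rw [Function.update_of_ne h, Function.update_of_ne h]

/-- Auxiliary (theorem `colOf_symm_update_right`): colOf symm update right. [folklore] -/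
theorem colOf_symm_update_right (V : Fin n → Col t) (i : Fin n) (y' : QReg t) :
    colOf (regX V) ((slices t n).symm (Function.update (slices t n (regY V)) i y')) =
      Function.update V i ((V i).1, y') := by
  funext i'
  simp only [colOf, Equiv.apply_symm_apply, slices_regY, slices_regX]
  by_cases h : i' = i
  · subst h
    simp
  · rw [Function.update_of_ne h, Function.update_of_ne h]

/-- Summing over registers that agree with a given one off column `i`. [folklore] -/
theorem sum_ite_update {α : Type*} [AddCommMonoid α] (Z : Fin n → QReg t) (i : Fin n)
    (φ : (Fin n → QReg t) → α) :
    ∑ F : Fin n → QReg t, (if (∀ i', i' ≠ i → Z i' = F i') then φ F else 0) =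
      ∑ x' : QReg t, φ (Function.update Z i x') := by
  classical
  rw [← Finset.sum_filter]
  have : Finset.univ.filter (fun F : Fin n → QReg t => ∀ i', i' ≠ i → Z i' = F i') =
      Finset.univ.image (fun x' => Function.update Z i x') := by
    ext F
    simp only [Finset.mem_filter, Finset.mem_univ, true_and, Finset.mem_image]
    constructor
    · intro h
      refine ⟨F i, ?_⟩
      funext i'
      by_cases hi' : i' = i
      · subst hi'
        simp
      · rw [Function.update_of_ne hi']
        exact h i' hi'
    · rintro ⟨x', rfl⟩ i' hi'
      rw [Function.update_of_ne hi']
  rw [this, Finset.sum_image]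
  intro x' _ x'' _ h
  have := congrFun h i
  simpa using this

/-! ### Placements of one-qubit gates and their tensor power action -/

/-- Entries of a one-qubit gate indexed by bits. [folklore] -/
def gate1 (G : Matrix (QReg 1) (QReg 1) ℂ) (a b : Bool) : ℂ := G (fun _ => a) (fun _ => b)

/-- Auxiliary (theorem `placeGate_one_apply`): placeGate one apply. [folklore] -/
theorem placeGate_one_apply (G : Matrix (QReg 1) (QReg 1) ℂ) (e : Fin 1 ↪ Fin n) (x y : QReg n) :
    Cryptography.placeGate e G x y =
      if (∀ i', i' ≠ e 0 → x i' = y i') then gate1 G (x (e 0)) (y (e 0)) else 0 := by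
  rw [Cryptography.placeGate_apply]
  have h1 : (∀ i', i' ∉ Set.range e → x i' = y i') ↔ ∀ i', i' ≠ e 0 → x i' = y i' := by
    have hr : ∀ i', i' ∉ Set.range e ↔ i' ≠ e 0 := by
      intro i'
      simp only [Set.mem_range, not_exists]
      constructor
      · intro h he
        exact h 0 he.symm
      · intro h k hk
        rw [Fin.fin_one_eq_zero k] at hk
        exact h hk.symm
    simp only [hr]
  have hx : x ∘ e = fun _ => x (e 0) := funext fun k => by simp [Fin.fin_one_eq_zero k]
  have hy : y ∘ e = fun _ => y (e 0) := funext fun k => by simp [Fin.fin_one_eq_zero k]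
  simp only [h1, hx, hy, gate1]

/-- Auxiliary (theorem `tPA_placeGate_one_apply`): tPA placeGate one apply. [folklore] -/
theorem tPA_placeGate_one_apply (G : Matrix (QReg 1) (QReg 1) ℂ) (e : Fin 1 ↪ Fin n)
    (z u : QReg (t * n)) :
    tensorPowerAction t (Cryptography.placeGate e G) z u =
      if (∀ i', i' ≠ e 0 → slices t n z i' = slices t n u i') then
        ∏ j, gate1 G (slices t n z (e 0) j) (slices t n u (e 0) j) else 0 := by
  rw [tensorPowerAction_apply]
  simp only [copies_apply, placeGate_one_apply]
  rw [Fintype.prod_ite_zero]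
  by_cases hq : ∀ i', i' ≠ e 0 → slices t n z i' = slices t n u i'
  · have hq' : ∀ (j : Fin t) (i' : Fin n), i' ≠ e 0 →
        z (finProdFinEquiv (j, i')) = u (finProdFinEquiv (j, i')) :=
      fun j i' hi' => congrFun (hq i' hi') j
    rw [if_pos hq', if_pos hq]
    rfl
  · have hq' : ¬ ∀ (j : Fin t) (i' : Fin n), i' ≠ e 0 →
        z (finProdFinEquiv (j, i')) = u (finProdFinEquiv (j, i')) :=
      fun h => hq fun i' hi' => funext fun j => h j i' hi'
    rw [if_neg hq', if_neg hq]

/-- Left action of a one-qubit placement on entry functions: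
`f_{C^{⊗t} A}(V) = ∑_{x'} G^{⊗t}_{x_i, x'} f_A(V[i ↦ (x', y_i)])`. [folklore] -/
theorem entryFun_tPA_one_mul (G : Matrix (QReg 1) (QReg 1) ℂ) (e : Fin 1 ↪ Fin n)
    (A : Matrix (QReg (t * n)) (QReg (t * n)) ℂ) (V : Fin n → Col t) :
    entryFun (tensorPowerAction t (Cryptography.placeGate e G) * A) V =
      ∑ x' : QReg t, (∏ j, gate1 G ((V (e 0)).1 j) (x' j)) *
        entryFun A (Function.update V (e 0) (x', (V (e 0)).2)) := by
  rw [entryFun_apply, Matrix.mul_apply]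
  rw [← Fintype.sum_equiv (slices t n).symm
    (fun F => tensorPowerAction t (Cryptography.placeGate e G) (regX V) ((slices t n).symm F) *
      A ((slices t n).symm F) (regY V)) _ (fun F => rfl)]
  simp only [tPA_placeGate_one_apply, Equiv.apply_symm_apply, slices_regX, ite_mul, zero_mul]
  rw [sum_ite_update]
  refine Finset.sum_congr rfl fun x' _ => ?_
  rw [Function.update_self, ← entryFun_colOf A, ← slices_regX V, colOf_symm_update_left]

/-- Right action of a one-qubit placement on entry functions:
`f_{A C^{⊗t}}(V) = ∑_{y'} f_A(V[i ↦ (x_i, y')]) G^{⊗t}_{y', y_i}`. [folklore] -/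
theorem entryFun_mul_tPA_one (G : Matrix (QReg 1) (QReg 1) ℂ) (e : Fin 1 ↪ Fin n)
    (A : Matrix (QReg (t * n)) (QReg (t * n)) ℂ) (V : Fin n → Col t) :
    entryFun (A * tensorPowerAction t (Cryptography.placeGate e G)) V =
      ∑ y' : QReg t, entryFun A (Function.update V (e 0) ((V (e 0)).1, y')) *
        ∏ j, gate1 G (y' j) ((V (e 0)).2 j) := by
  rw [entryFun_apply, Matrix.mul_apply]
  rw [← Fintype.sum_equiv (slices t n).symm
    (fun F => A (regX V) ((slices t n).symm F) *
      tensorPowerAction t (Cryptography.placeGate e G) ((slices t n).symm F) (regY V)) _ (fun F => rfl)]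
  simp only [tPA_placeGate_one_apply, Equiv.apply_symm_apply, slices_regY, mul_ite, mul_zero]
  have : ∀ F : Fin n → QReg t, (∀ i', i' ≠ e 0 → F i' = (V i').2) ↔
      ∀ i', i' ≠ e 0 → (fun i => (V i).2) i' = F i' := fun F =>
    ⟨fun h i' hi' => (h i' hi').symm, fun h i' hi' => (h i' hi').symm⟩
  simp only [this]
  rw [sum_ite_update]
  refine Finset.sum_congr rfl fun y' _ => ?_
  rw [Function.update_self, ← entryFun_colOf A, ← slices_regY V, colOf_symm_update_right]

/-- The phase gate `S = diag(1, i)` on bits. [folklore] -/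
theorem gate1_sGate (a b : Bool) : gate1 Cryptography.sGate a b = if a = b then cI a else 0 := by
  simp only [gate1, Cryptography.sGate, Matrix.of_apply, cI]
  have : ((fun _ : Fin 1 => a) = fun _ => b) ↔ a = b :=
    ⟨fun h => congrFun h 0, fun h => h ▸ rfl⟩
  simp only [this]

/-- Auxiliary (theorem `prod_gate1_sGate`): prod gate1 sGate. [folklore] -/
theorem prod_gate1_sGate (x x' : QReg t) :
    ∏ j, gate1 Cryptography.sGate (x j) (x' j) = if x = x' then ∏ j, cI (x j) else 0 := by
  simp only [gate1_sGate]
  rw [Fintype.prod_ite_zero]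
  by_cases h : x = x'
  · rw [if_pos h, if_pos (fun j => congrFun h j)]
  · rw [if_neg h, if_neg (fun h' => h (funext h'))]

/-- The Hadamard gate on bits: `H_{a,b} = (-1)^{ab}/√2`. [folklore] -/
theorem gate1_hGate (a b : Bool) :
    gate1 Cryptography.hGate a b = (1 / (Real.sqrt 2 : ℂ)) * sgn (a * b) := by
  simp only [gate1, Cryptography.hGate, Matrix.of_apply, sgn, Bool.mul_eq_and]
  cases a <;> cases b <;> simp

/-- Auxiliary (theorem `prod_gate1_hGate`): prod gate1 hGate. [folklore] -/
theorem prod_gate1_hGate (x x' : QReg t) :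
    ∏ j, gate1 Cryptography.hGate (x j) (x' j) = (1 / (Real.sqrt 2 : ℂ)) ^ t * sgn (x ⬝ᵥ x') := by
  simp only [gate1_hGate]
  rw [Finset.prod_mul_distrib, Finset.prod_const, Finset.card_univ, Fintype.card_fin, dotProduct, sgn_sum]

/-! ### Placements of `CNOT` and their tensor power action -/

/-- The column operation `z ↦ z[col b ↦ col b + col a]` induced by `CNOT_{a→b}^{⊗t}`. [folklore] -/
def addCol (a b : Fin n) (z : QReg (t * n)) : QReg (t * n) :=
  (slices t n).symm (Function.update (slices t n z) b (slices t n z b + slices t n z a))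

/-- Auxiliary (theorem `slices_addCol`): slices addCol. [folklore] -/
theorem slices_addCol (a b : Fin n) (z : QReg (t * n)) :
    slices t n (addCol a b z) = Function.update (slices t n z) b (slices t n z b + slices t n z a) :=
  Equiv.apply_symm_apply _ _

/-- Auxiliary (theorem `addCol_addCol`): addCol addCol. [folklore] -/
theorem addCol_addCol {a b : Fin n} (hab : a ≠ b) (z : QReg (t * n)) : addCol a b (addCol a b z) = z := by
  apply (slices t n).injective
  rw [slices_addCol, slices_addCol]
  funext i
  by_cases hi : i = b
  · subst hi
    rw [Function.update_self, Function.update_self, Function.update_of_ne hab, add_assoc]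
    have : slices t n z a + slices t n z a = 0 := by
      funext j; exact BooleanRing.add_self _
    rw [this, add_zero]
  · rw [Function.update_of_ne hi, Function.update_of_ne hi]

/-- Auxiliary (theorem `addCol_apply`): addCol apply. [folklore] -/
theorem addCol_apply (a b : Fin n) (u : QReg (t * n)) (j : Fin t) (i' : Fin n) :
    addCol a b u (finProdFinEquiv (j, i')) =
      if i' = b then (u (finProdFinEquiv (j, b)) ^^ u (finProdFinEquiv (j, a)))
      else u (finProdFinEquiv (j, i')) := by
  have h := congrFun (congrFun (slices_addCol (t := t) a b u) i') j
  change addCol a b u (finProdFinEquiv (j, i')) = _ at h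
  rw [h]
  by_cases hi : i' = b
  · subst hi
    rw [Function.update_self, if_pos rfl]
    rfl
  · rw [Function.update_of_ne hi, if_neg hi]
    rfl

/-- The bit map of `CNOT` with control `e 0` and target `e 1`. [folklore] -/
def cnotMap (e : Fin 2 ↪ Fin n) (y : QReg n) : QReg n :=
  Function.update y (e 1) (y (e 1) ^^ y (e 0))

/-- Auxiliary (theorem `cnotMap_apply`): cnotMap apply. [folklore] -/
theorem cnotMap_apply (e : Fin 2 ↪ Fin n) (y : QReg n) (i' : Fin n) :
    cnotMap e y i' = if i' = e 1 then (y (e 1) ^^ y (e 0)) else y i' := by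
  unfold cnotMap
  by_cases h : i' = e 1
  · subst h
    rw [Function.update_self, if_pos rfl]
  · rw [Function.update_of_ne h, if_neg h]

/-- A placed `CNOT` is the permutation matrix of `cnotMap`. [folklore] -/
theorem placeGate_cnot_apply' (e : Fin 2 ↪ Fin n) (x y : QReg n) :
    Cryptography.placeGate e Cryptography.cnot x y = if x = cnotMap e y then 1 else 0 := by
  have hab : e 0 ≠ e 1 := fun h => by simpa using e.injective h
  have hr : ∀ i', i' ∉ Set.range e ↔ (i' ≠ e 0 ∧ i' ≠ e 1) := by
    intro i'
    simp only [Set.mem_range, not_exists, Fin.forall_fin_two]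
    exact ⟨fun h => ⟨fun h' => h.1 h'.symm, fun h' => h.2 h'.symm⟩,
      fun h => ⟨fun h' => h.1 h'.symm, fun h' => h.2 h'.symm⟩⟩
  rw [Cryptography.placeGate_apply]
  by_cases hx : x = cnotMap e y
  · subst hx
    rw [if_pos rfl, if_pos (show ∀ i, i ∉ Set.range e → cnotMap e y i = y i from
      fun i hi => by rw [hr] at hi; rw [cnotMap, Function.update_of_ne hi.2])]
    simp [Cryptography.cnot, cnotMap]
  · rw [if_neg hx]
    split_ifs with h1
    · simp only [Cryptography.cnot, Matrix.of_apply, Function.comp_apply]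
      rw [if_neg]
      rintro ⟨h0, h1'⟩
      apply hx
      funext i
      by_cases hi1 : i = e 1
      · subst hi1
        rw [cnotMap, Function.update_self, h1']
      · rw [cnotMap, Function.update_of_ne hi1]
        by_cases hi0 : i = e 0
        · subst hi0
          exact h0
        · exact h1 i ((hr i).2 ⟨hi0, hi1⟩)
    · rfl

/-- Auxiliary (theorem `tPA_placeGate_cnot_apply`): tPA placeGate cnot apply. [folklore] -/
theorem tPA_placeGate_cnot_apply (e : Fin 2 ↪ Fin n) (z u : QReg (t * n)) :
    tensorPowerAction t (Cryptography.placeGate e Cryptography.cnot) z u =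
      if u = addCol (e 0) (e 1) z then 1 else 0 := by
  have hab : e 0 ≠ e 1 := fun h => by simpa using e.injective h
  rw [tensorPowerAction_apply]
  simp only [placeGate_cnot_apply']
  rw [Fintype.prod_boole]
  have key : (∀ j, copies t n z j = cnotMap e (copies t n u j)) ↔ z = addCol (e 0) (e 1) u := by
    constructor
    · intro h
      funext k
      obtain ⟨⟨j, i'⟩, rfl⟩ := finProdFinEquiv.surjective k
      have h' := congrFun (h j) i'
      simp only [copies_apply, cnotMap_apply] at h'
      rw [addCol_apply]
      exact h'
    · intro h j
      funext i'
      simp only [copies_apply, cnotMap_apply]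
      rw [h, addCol_apply]
  have key' : (∀ j, copies t n z j = cnotMap e (copies t n u j)) ↔ u = addCol (e 0) (e 1) z := by
    rw [key]
    constructor
    · intro h; rw [h, addCol_addCol hab]
    · intro h; rw [h, addCol_addCol hab]
  by_cases h : u = addCol (e 0) (e 1) z
  · rw [if_pos h, if_pos (key'.2 h)]
  · rw [if_neg h, if_neg (fun h' => h (key'.1 h'))]

/-- Left and right action of a `CNOT` placement on entry functions. [folklore] -/
theorem entryFun_tPA_cnot_mul (e : Fin 2 ↪ Fin n) (A : Matrix (QReg (t * n)) (QReg (t * n)) ℂ)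
    (V : Fin n → Col t) :
    entryFun (tensorPowerAction t (Cryptography.placeGate e Cryptography.cnot) * A) V =
      entryFun A (Function.update V (e 1) ((V (e 1)).1 + (V (e 0)).1, (V (e 1)).2)) := by
  rw [entryFun_apply, Matrix.mul_apply]
  simp only [tPA_placeGate_cnot_apply, ite_mul, one_mul, zero_mul, Finset.sum_ite_eq',
    Finset.mem_univ, if_true]
  rw [← entryFun_colOf A]
  congr 1
  funext i'
  simp only [colOf, slices_addCol, slices_regY, slices_regX]
  by_cases h : i' = e 1
  · subst h
    simp
  · rw [Function.update_of_ne h, Function.update_of_ne h]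

/-- Auxiliary (theorem `entryFun_mul_tPA_cnot`): entryFun mul tPA cnot. [folklore] -/
theorem entryFun_mul_tPA_cnot (e : Fin 2 ↪ Fin n) (A : Matrix (QReg (t * n)) (QReg (t * n)) ℂ)
    (V : Fin n → Col t) :
    entryFun (A * tensorPowerAction t (Cryptography.placeGate e Cryptography.cnot)) V =
      entryFun A (Function.update V (e 1) ((V (e 1)).1, (V (e 1)).2 + (V (e 0)).2)) := by
  have hab : e 0 ≠ e 1 := fun h => by simpa using e.injective h
  rw [entryFun_apply, Matrix.mul_apply]
  simp only [tPA_placeGate_cnot_apply, mul_ite, mul_one, mul_zero]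
  have : ∀ u : QReg (t * n), (regY V = addCol (e 0) (e 1) u) ↔ (u = addCol (e 0) (e 1) (regY V)) := by
    intro u
    constructor
    · intro h; rw [h, addCol_addCol hab]
    · intro h; rw [h, addCol_addCol hab]
  simp only [this, Finset.sum_ite_eq', Finset.mem_univ, if_true]
  rw [← entryFun_colOf A]
  congr 1
  funext i'
  simp only [colOf, slices_addCol, slices_regY, slices_regX]
  by_cases h : i' = e 1
  · subst h
    simp
  · rw [Function.update_of_ne h, Function.update_of_ne h]

end EntryFun

/-! ### The commutant in terms of entry functions -/

section Commutant

variable {n : ℕ}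

/-- Auxiliary (theorem `QReg.add_self`): QReg.add self. [folklore] -/
theorem QReg.add_self (y : QReg t) : y + y = 0 := by
  funext j; exact BooleanRing.add_self _

/-- Auxiliary (theorem `QReg.add_add_cancel_right`): QReg.add add cancel right. [folklore] -/
theorem QReg.add_add_cancel_right (y y' : QReg t) : y + y' + y' = y := by
  rw [add_assoc, QReg.add_self, add_zero]

/-- Auxiliary (theorem `QReg.add_eq_zero_iff`): QReg.add eq zero iff. [folklore] -/
theorem QReg.add_eq_zero_iff (y y' : QReg t) : y + y' = 0 ↔ y' = y := by
  constructor
  · intro h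
    calc y' = y + y + y' := by rw [QReg.add_self, zero_add]
      _ = y := by rw [add_assoc, h, add_zero]
  · intro h
    rw [h]
    exact QReg.add_self _

/-- Auxiliary (theorem `sgn_dot`): sgn dot. [folklore] -/
theorem sgn_dot (u v : QReg t) : sgn (u ⬝ᵥ v) = ∏ j, sgn (u j * v j) := by
  rw [dotProduct, sgn_sum]

/-- One-component orthogonality: `∑_v (-1)^{u·v} = 2^t [u = 0]`. [folklore] -/
theorem sum_sgn_dot (u : QReg t) : ∑ v : QReg t, sgn (u ⬝ᵥ v) = if u = 0 then (2 : ℂ) ^ t else 0 := by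
  simp_rw [sgn_dot]
  exact sum_prod_sgn u

/-- Membership in the commutant is tested on the placements of `H`, `S`, `CNOT`.
[cite: GrossNezamiWalter2021, proof of Lem. 4.3 (generators of the Clifford group)] -/
theorem mem_cliffordCommutant_iff_placements {A : Matrix (QReg (t * n)) (QReg (t * n)) ℂ} :
    A ∈ cliffordCommutant t n ↔ ∀ C ∈ Cryptography.placements clifford n,
      tensorPowerAction t C * A = A * tensorPowerAction t C := by
  rw [mem_cliffordCommutant_iff]
  constructor
  · intro h C hC
    exact h C (Submonoid.subset_closure hC)
  · intro h C hC
    unfold cliffordCircuits at hC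
    induction hC using Submonoid.closure_induction with
    | mem C hC => exact h C hC
    | one => rw [tensorPowerAction_one, Matrix.one_mul, Matrix.mul_one]
    | mul C D _ _ ihC ihD =>
      rw [tensorPowerAction_mul, Matrix.mul_assoc, ihD, ← Matrix.mul_assoc, ihC, Matrix.mul_assoc]

/-- The placements of the Clifford gate set. [folklore] -/
theorem placements_clifford_iff {C : Matrix (QReg n) (QReg n) ℂ} :
    C ∈ Cryptography.placements clifford n ↔
      (∃ e : Fin 1 ↪ Fin n, C = Cryptography.placeGate e Cryptography.hGate) ∨
      (∃ e : Fin 1 ↪ Fin n, C = Cryptography.placeGate e Cryptography.sGate) ∨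
      (∃ e : Fin 2 ↪ Fin n, C = Cryptography.placeGate e Cryptography.cnot) := by
  constructor
  · rintro ⟨g, e, rfl⟩
    cases g with
    | H => exact Or.inl ⟨e, rfl⟩
    | S => exact Or.inr (Or.inl ⟨e, rfl⟩)
    | CNOT => exact Or.inr (Or.inr ⟨e, rfl⟩)
  · rintro (⟨e, rfl⟩ | ⟨e, rfl⟩ | ⟨e, rfl⟩)
    · exact ⟨CliffordOp.H, e, rfl⟩
    · exact ⟨CliffordOp.S, e, rfl⟩
    · exact ⟨CliffordOp.CNOT, e, rfl⟩

/-- Auxiliary (theorem `entryFun_sGate_mul`): entryFun sGate mul. [folklore] -/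
theorem entryFun_sGate_mul (e : Fin 1 ↪ Fin n) (A : Matrix (QReg (t * n)) (QReg (t * n)) ℂ)
    (V : Fin n → Col t) :
    entryFun (tensorPowerAction t (Cryptography.placeGate e Cryptography.sGate) * A) V =
      (∏ j, cI ((V (e 0)).1 j)) * entryFun A V := by
  rw [entryFun_tPA_one_mul]
  simp only [prod_gate1_sGate, ite_mul, zero_mul, Finset.sum_ite_eq, Finset.mem_univ, if_true,
    Prod.mk.eta, Function.update_eq_self]

/-- Auxiliary (theorem `entryFun_mul_sGate`): entryFun mul sGate. [folklore] -/
theorem entryFun_mul_sGate (e : Fin 1 ↪ Fin n) (A : Matrix (QReg (t * n)) (QReg (t * n)) ℂ)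
    (V : Fin n → Col t) :
    entryFun (A * tensorPowerAction t (Cryptography.placeGate e Cryptography.sGate)) V =
      entryFun A V * ∏ j, cI ((V (e 0)).2 j) := by
  rw [entryFun_mul_tPA_one]
  simp only [prod_gate1_sGate, mul_ite, mul_zero, Finset.sum_ite_eq', Finset.mem_univ, if_true,
    Prod.mk.eta, Function.update_eq_self]

/-- Auxiliary (theorem `entryFun_hGate_mul`): entryFun hGate mul. [folklore] -/
theorem entryFun_hGate_mul (e : Fin 1 ↪ Fin n) (A : Matrix (QReg (t * n)) (QReg (t * n)) ℂ)
    (V : Fin n → Col t) :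
    entryFun (tensorPowerAction t (Cryptography.placeGate e Cryptography.hGate) * A) V =
      (1 / (Real.sqrt 2 : ℂ)) ^ t * ∑ x' : QReg t, sgn ((V (e 0)).1 ⬝ᵥ x') *
        entryFun A (Function.update V (e 0) (x', (V (e 0)).2)) := by
  rw [entryFun_tPA_one_mul, Finset.mul_sum]
  simp only [prod_gate1_hGate, mul_assoc]

/-- Auxiliary (theorem `entryFun_mul_hGate`): entryFun mul hGate. [folklore] -/
theorem entryFun_mul_hGate (e : Fin 1 ↪ Fin n) (A : Matrix (QReg (t * n)) (QReg (t * n)) ℂ)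
    (V : Fin n → Col t) :
    entryFun (A * tensorPowerAction t (Cryptography.placeGate e Cryptography.hGate)) V =
      (1 / (Real.sqrt 2 : ℂ)) ^ t * ∑ y' : QReg t,
        entryFun A (Function.update V (e 0) ((V (e 0)).1, y')) * sgn (y' ⬝ᵥ (V (e 0)).2) := by
  rw [entryFun_mul_tPA_one, Finset.mul_sum]
  simp only [prod_gate1_hGate]
  refine Finset.sum_congr rfl fun y' _ => ?_
  ring

/-- Commutation with `S^{⊗t}` on qubit `i` in terms of entries. [cite: GrossNezamiWalter2021, proof of Lem. 4.3 (phase gate)] -/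
theorem commute_sGate_iff (e : Fin 1 ↪ Fin n) (A : Matrix (QReg (t * n)) (QReg (t * n)) ℂ) :
    tensorPowerAction t (Cryptography.placeGate e Cryptography.sGate) * A =
        A * tensorPowerAction t (Cryptography.placeGate e Cryptography.sGate) ↔
      ∀ V : Fin n → Col t, (∏ j, cI ((V (e 0)).1 j)) * entryFun A V =
        entryFun A V * ∏ j, cI ((V (e 0)).2 j) := by
  constructor
  · intro h V
    rw [← entryFun_sGate_mul, ← entryFun_mul_sGate, h]
  · intro h
    apply eq_of_entryFun_eq
    funext V
    rw [entryFun_sGate_mul, entryFun_mul_sGate, h V]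

/-- Commutation with `H^{⊗t}` on qubit `i` in terms of entries ("half" Hadamard relation).
[cite: GrossNezamiWalter2021, proof of Lem. 4.3 (Fourier transform)] -/
theorem commute_hGate_iff (e : Fin 1 ↪ Fin n) (A : Matrix (QReg (t * n)) (QReg (t * n)) ℂ) :
    tensorPowerAction t (Cryptography.placeGate e Cryptography.hGate) * A =
        A * tensorPowerAction t (Cryptography.placeGate e Cryptography.hGate) ↔
      ∀ V : Fin n → Col t, ∑ x' : QReg t, sgn ((V (e 0)).1 ⬝ᵥ x') *
          entryFun A (Function.update V (e 0) (x', (V (e 0)).2)) =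
        ∑ y' : QReg t, entryFun A (Function.update V (e 0) ((V (e 0)).1, y')) *
          sgn (y' ⬝ᵥ (V (e 0)).2) := by
  have hc : (1 / (Real.sqrt 2 : ℂ)) ^ t ≠ 0 := by
    apply pow_ne_zero
    rw [one_div]
    apply inv_ne_zero
    exact_mod_cast Real.sqrt_ne_zero'.2 two_pos
  constructor
  · intro h V
    apply mul_left_cancel₀ hc
    rw [← entryFun_hGate_mul, ← entryFun_mul_hGate, h]
  · intro h
    apply eq_of_entryFun_eq
    funext V
    rw [entryFun_hGate_mul, entryFun_mul_hGate, h V]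

/-- Commutation with `CNOT^{⊗t}` in terms of entries. [cite: GrossNezamiWalter2021, proof of Lem. 4.3 (controlled addition)] -/
theorem commute_cnot_iff (e : Fin 2 ↪ Fin n) (A : Matrix (QReg (t * n)) (QReg (t * n)) ℂ) :
    tensorPowerAction t (Cryptography.placeGate e Cryptography.cnot) * A =
        A * tensorPowerAction t (Cryptography.placeGate e Cryptography.cnot) ↔
      ∀ V : Fin n → Col t, entryFun A (Function.update V (e 1) ((V (e 1)).1 + (V (e 0)).1, (V (e 1)).2)) =
        entryFun A (Function.update V (e 1) ((V (e 1)).1, (V (e 1)).2 + (V (e 0)).2)) := by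
  constructor
  · intro h V
    rw [← entryFun_tPA_cnot_mul, ← entryFun_mul_tPA_cnot, h]
  · intro h
    apply eq_of_entryFun_eq
    funext V
    rw [entryFun_tPA_cnot_mul, entryFun_mul_tPA_cnot, h V]

/-- The two half-updates of `CNOT` versus the full column addition. [folklore] -/
theorem colAdd_iff_halves {f : (Fin n → Col t) → ℂ} {a b : Fin n} (hab : a ≠ b) :
    (∀ V : Fin n → Col t, f (Function.update V b ((V b).1 + (V a).1, (V b).2)) =
        f (Function.update V b ((V b).1, (V b).2 + (V a).2))) ↔
      ∀ V : Fin n → Col t, f (Function.update V b (V b + V a)) = f V := by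
  -- `W = V[b ↦ (x_b, y_b + y_a)]`
  have keyA : ∀ V : Fin n → Col t,
      Function.update (Function.update V b ((V b).1, (V b).2 + (V a).2)) b
          (((Function.update V b ((V b).1, (V b).2 + (V a).2)) b).1 +
              ((Function.update V b ((V b).1, (V b).2 + (V a).2)) a).1,
            ((Function.update V b ((V b).1, (V b).2 + (V a).2)) b).2) =
        Function.update V b (V b + V a) := by
    intro V
    simp only [Function.update_self, Function.update_of_ne hab, Function.update_idem]
    rfl
  have keyB : ∀ V : Fin n → Col t,
      Function.update (Function.update V b ((V b).1, (V b).2 + (V a).2)) b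
          (((Function.update V b ((V b).1, (V b).2 + (V a).2)) b).1,
            ((Function.update V b ((V b).1, (V b).2 + (V a).2)) b).2 +
              ((Function.update V b ((V b).1, (V b).2 + (V a).2)) a).2) = V := by
    intro V
    simp only [Function.update_self, Function.update_of_ne hab, Function.update_idem]
    rw [QReg.add_add_cancel_right, Prod.mk.eta, Function.update_eq_self]
  have keyC : ∀ V : Fin n → Col t,
      Function.update (Function.update V b ((V b).1, (V b).2 + (V a).2)) b
          ((Function.update V b ((V b).1, (V b).2 + (V a).2)) b +
            (Function.update V b ((V b).1, (V b).2 + (V a).2)) a) =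
        Function.update V b ((V b).1 + (V a).1, (V b).2) := by
    intro V
    simp only [Function.update_self, Function.update_of_ne hab, Function.update_idem]
    congr 1
    exact Prod.ext rfl (QReg.add_add_cancel_right _ _)
  constructor
  · intro h V
    have := h (Function.update V b ((V b).1, (V b).2 + (V a).2))
    rw [keyA V, keyB V] at this
    exact this
  · intro h V
    have := h (Function.update V b ((V b).1, (V b).2 + (V a).2))
    rw [keyC V] at this
    exact this

/-- From the half Hadamard relation (commutation) to the full one (conjugation invariance). [folklore] -/
theorem hada_of_half {f : (Fin n → Col t) → ℂ} (i : Fin n)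
    (h : ∀ V : Fin n → Col t, ∑ x' : QReg t, sgn ((V i).1 ⬝ᵥ x') * f (Function.update V i (x', (V i).2)) =
      ∑ y' : QReg t, f (Function.update V i ((V i).1, y')) * sgn (y' ⬝ᵥ (V i).2))
    (V : Fin n → Col t) :
    f V = ((2 : ℂ) ^ t)⁻¹ * ∑ w : Col t, sgn (bilin (V i) w) * f (Function.update V i w) := by
  have hF : ∀ x₁ y₁ : QReg t, ∑ x' : QReg t, sgn (x₁ ⬝ᵥ x') * f (Function.update V i (x', y₁)) =
      ∑ y' : QReg t, f (Function.update V i (x₁, y')) * sgn (y' ⬝ᵥ y₁) := by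
    intro x₁ y₁
    have := h (Function.update V i (x₁, y₁))
    simpa only [Function.update_self, Function.update_idem] using this
  have h2 : ((2 : ℂ) ^ t) ≠ 0 := pow_ne_zero _ two_ne_zero
  symm
  calc ((2 : ℂ) ^ t)⁻¹ * ∑ w : Col t, sgn (bilin (V i) w) * f (Function.update V i w)
      = ((2 : ℂ) ^ t)⁻¹ * ∑ y' : QReg t, sgn ((V i).2 ⬝ᵥ y') *
          ∑ x' : QReg t, sgn ((V i).1 ⬝ᵥ x') * f (Function.update V i (x', y')) := by
        congr 1
        rw [Fintype.sum_prod_type, Finset.sum_comm]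
        refine Finset.sum_congr rfl fun y' _ => ?_
        rw [Finset.mul_sum]
        refine Finset.sum_congr rfl fun x' _ => ?_
        rw [bilin, sgn_add]
        ring
    _ = ((2 : ℂ) ^ t)⁻¹ * ∑ y' : QReg t, sgn ((V i).2 ⬝ᵥ y') *
          ∑ y'' : QReg t, f (Function.update V i ((V i).1, y'')) * sgn (y'' ⬝ᵥ y') := by
        simp_rw [hF]
    _ = ((2 : ℂ) ^ t)⁻¹ * ∑ y'' : QReg t, f (Function.update V i ((V i).1, y'')) *
          ∑ y' : QReg t, sgn (((V i).2 + y'') ⬝ᵥ y') := by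
        congr 1
        simp_rw [Finset.mul_sum]
        rw [Finset.sum_comm]
        refine Finset.sum_congr rfl fun y'' _ => Finset.sum_congr rfl fun y' _ => ?_
        rw [add_dotProduct, sgn_add, dotProduct_comm y'' y']
        ring
    _ = ((2 : ℂ) ^ t)⁻¹ * ∑ y'' : QReg t, f (Function.update V i ((V i).1, y'')) *
          (if y'' = (V i).2 then (2 : ℂ) ^ t else 0) := by
        congr 1
        refine Finset.sum_congr rfl fun y'' _ => ?_
        rw [sum_sgn_dot]
        simp only [QReg.add_eq_zero_iff]
    _ = f V := by
        simp only [mul_ite, mul_zero, Finset.sum_ite_eq', Finset.mem_univ, if_true, Prod.mk.eta,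
          Function.update_eq_self]
        field_simp

/-- The embedding of one wire. [folklore] -/
def emb1 (i : Fin n) : Fin 1 ↪ Fin n := ⟨fun _ => i, fun a b _ => Subsingleton.elim a b⟩

/-- Auxiliary (theorem `emb1_apply`): emb1 apply. [folklore] -/
@[simp] theorem emb1_apply (i : Fin n) (k : Fin 1) : emb1 i k = i := rfl

/-- The embedding of two distinct wires. [folklore] -/
def emb2 (a b : Fin n) (h : a ≠ b) : Fin 2 ↪ Fin n :=
  ⟨![a, b], fun x y hxy => by
    fin_cases x <;> fin_cases y
    · rfl
    · exact absurd (by simpa using hxy) h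
    · exact absurd (by simpa using hxy.symm) h
    · rfl⟩

/-- Auxiliary (theorem `emb2_zero`): emb2 zero. [folklore] -/
@[simp] theorem emb2_zero (a b : Fin n) (h : a ≠ b) : emb2 a b h 0 = a := rfl
/-- Auxiliary (theorem `emb2_one`): emb2 one. [folklore] -/
@[simp] theorem emb2_one (a b : Fin n) (h : a ≠ b) : emb2 a b h 1 = b := rfl

/-- Auxiliary (theorem `qchar_eq_one_of_prod_cI_eq`): qchar eq one of prod cI eq. [folklore] -/
theorem qchar_eq_one_of_prod_cI_eq {v : Col t} (h : ∏ j, cI (v.1 j) = ∏ j, cI (v.2 j)) :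
    qchar v = 1 := by
  rw [qchar, h, ← Finset.prod_mul_distrib]
  simp [cI_mul_cJ]

/-- Auxiliary (theorem `prod_cI_eq_of_qchar_eq_one`): prod cI eq of qchar eq one. [folklore] -/
theorem prod_cI_eq_of_qchar_eq_one {v : Col t} (h : qchar v = 1) :
    ∏ j, cI (v.1 j) = ∏ j, cI (v.2 j) := by
  have hy : (∏ j, cI (v.2 j)) * ∏ j, cJ (v.2 j) = 1 := by
    rw [← Finset.prod_mul_distrib]
    simp [cI_mul_cJ]
  rw [qchar] at h
  calc ∏ j, cI (v.1 j) = (∏ j, cI (v.1 j)) * ((∏ j, cI (v.2 j)) * ∏ j, cJ (v.2 j)) := by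
        rw [hy, mul_one]
    _ = (∏ j, cI (v.2 j)) * ((∏ j, cI (v.1 j)) * ∏ j, cJ (v.2 j)) := by ring
    _ = ∏ j, cI (v.2 j) := by rw [h, mul_one]

/-- **The entry function of an operator in the commutant satisfies the three Clifford relations.**
[cite: GrossNezamiWalter2021, proof of Lem. 4.3 (action of H, P, CADD)] -/
theorem isCliffInv_entryFun {A : Matrix (QReg (t * n)) (QReg (t * n)) ℂ} (hA : A ∈ cliffordCommutant t n) :
    IsCliffInv t n (entryFun A) := by
  rw [mem_cliffordCommutant_iff_placements] at hA
  refine ⟨⟨fun V i j hij => ?_⟩, fun V i hV => ?_, fun V j => ?_⟩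
  · have h := (commute_cnot_iff (emb2 i j hij) A).1
      (hA _ (placements_clifford_iff.2 (Or.inr (Or.inr ⟨_, rfl⟩))))
    simp only [emb2_zero, emb2_one] at h
    exact (colAdd_iff_halves hij).1 h V
  · have h := (commute_sGate_iff (emb1 i) A).1
      (hA _ (placements_clifford_iff.2 (Or.inr (Or.inl ⟨_, rfl⟩)))) V
    simp only [emb1_apply] at h
    apply qchar_eq_one_of_prod_cI_eq
    rw [mul_comm] at h
    exact mul_left_cancel₀ hV h
  · have h := (commute_hGate_iff (emb1 j) A).1
      (hA _ (placements_clifford_iff.2 (Or.inl ⟨_, rfl⟩)))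
    simp only [emb1_apply] at h
    exact hada_of_half j h V

/-! ### `R(T)` lies in the commutant (GNW Lemma 4.3) -/

/-- The indicator of a conjunction is the product of the indicators. [folklore] -/
theorem ite_and_eq_mul (P Q : Prop) [Decidable P] [Decidable Q] :
    (if P ∧ Q then (1 : ℂ) else 0) = (if P then 1 else 0) * (if Q then 1 else 0) := by
  split_ifs <;> simp_all

/-- Auxiliary (theorem `forall_update_iff`): forall update iff. [folklore] -/
theorem forall_update_iff {T : Finset (Col t)} (V : Fin n → Col t) (i : Fin n) (c : Col t) :
    (∀ i', Function.update V i c i' ∈ T) ↔ c ∈ T ∧ ∀ i', i' ≠ i → V i' ∈ T := by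
  constructor
  · intro h
    refine ⟨by simpa using h i, fun i' hi' => ?_⟩
    have := h i'
    rwa [Function.update_of_ne hi'] at this
  · rintro ⟨hc, h⟩ i'
    by_cases hi' : i' = i
    · subst hi'
      simpa using hc
    · rw [Function.update_of_ne hi']
      exact h i' hi'

/-- Auxiliary (theorem `entryFun_R_update`): entryFun R update. [folklore] -/
theorem entryFun_R_update {T : Finset (Col t)} (V : Fin n → Col t) (i : Fin n) (c : Col t) :
    entryFun (cliffordCodeOperator T n) (Function.update V i c) =
      (if c ∈ T then (1 : ℂ) else 0) * (if ∀ i', i' ≠ i → V i' ∈ T then 1 else 0) := by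
  rw [entryFun_cliffordCodeOperator]
  simp only [forall_update_iff V i c]
  exact ite_and_eq_mul _ _

/-- The indicator of a Lagrangian as a character sum: `[c ∈ T] = 2^{-t} ∑_{v ∈ T} (-1)^{β(v,c)}`
(`T = T^⊥`). [cite: GrossNezamiWalter2021, proof of Lem. 4.3 (Fourier transform, T = T^⊥)] -/
theorem indicator_eq_sum_sgn {T : Finset (Col t)} (hT : IsLagr T) (c : Col t) :
    (if c ∈ T then (1 : ℂ) else 0) = ((2 : ℂ) ^ t)⁻¹ * ∑ v ∈ T, sgn (bilin v c) := by
  rw [sum_sgn_bilin_sub hT.isSub c, perp_eq_of_card hT.isSub hT.iso hT.card_eq, hT.card_eq]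
  push_cast
  split_ifs
  · field_simp
  · rw [mul_zero]

/-- The core of the Hadamard commutation for `r(T)`:
`∑_{x'} (-1)^{x·x'} [(x', y) ∈ T] = ∑_{y'} [(x, y') ∈ T] (-1)^{y'·y}`.
[cite: GrossNezamiWalter2021, proof of Lem. 4.3 (H^{⊗t} r(T) H^{†⊗t} = r(T))] -/
theorem hada_core {T : Finset (Col t)} (hT : IsLagr T) (x y : QReg t) :
    ∑ x' : QReg t, sgn (x ⬝ᵥ x') * (if (x', y) ∈ T then (1 : ℂ) else 0) =
      ∑ y' : QReg t, (if (x, y') ∈ T then (1 : ℂ) else 0) * sgn (y' ⬝ᵥ y) := by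
  have h2 : ((2 : ℂ) ^ t) ≠ 0 := pow_ne_zero _ two_ne_zero
  -- both sides equal `∑_{v ∈ T, v.1 = x} sgn (v.2 · y)`
  have hR : ∑ y' : QReg t, (if (x, y') ∈ T then (1 : ℂ) else 0) * sgn (y' ⬝ᵥ y) =
      ∑ v ∈ T, if v.1 = x then sgn (v.2 ⬝ᵥ y) else 0 := by
    have e : ∑ v ∈ T, (if v.1 = x then sgn (v.2 ⬝ᵥ y) else 0) =
        ∑ v : Col t, if v ∈ T then (if v.1 = x then sgn (v.2 ⬝ᵥ y) else 0) else 0 := by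
      symm
      rw [Finset.sum_ite_mem, Finset.univ_inter]
    rw [e, Fintype.sum_prod_type, Finset.sum_comm]
    refine Finset.sum_congr rfl fun y' _ => ?_
    dsimp only
    rw [Finset.sum_eq_single x]
    · simp only [if_true, ite_mul, one_mul, zero_mul]
    · intro a _ ha
      rw [if_neg ha, ite_self]
    · intro hx
      exact absurd (Finset.mem_univ x) hx
  have hL : ∑ x' : QReg t, sgn (x ⬝ᵥ x') * (if (x', y) ∈ T then (1 : ℂ) else 0) =
      ∑ v ∈ T, if v.1 = x then sgn (v.2 ⬝ᵥ y) else 0 := by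
    simp_rw [indicator_eq_sum_sgn hT, Finset.mul_sum]
    rw [Finset.sum_comm]
    refine Finset.sum_congr rfl fun v _ => ?_
    have e : ∀ x' : QReg t, sgn (x ⬝ᵥ x') * (((2 : ℂ) ^ t)⁻¹ * sgn (bilin v (x', y))) =
        ((2 : ℂ) ^ t)⁻¹ * sgn (v.2 ⬝ᵥ y) * sgn ((x + v.1) ⬝ᵥ x') := by
      intro x'
      rw [bilin, sgn_add, add_dotProduct, sgn_add, dotProduct_comm v.1 x']
      ring
    simp_rw [e]
    rw [← Finset.mul_sum, sum_sgn_dot]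
    by_cases hv : v.1 = x
    · rw [if_pos hv, if_pos (show x + v.1 = 0 by rw [hv]; exact QReg.add_self x)]
      field_simp
    · rw [if_neg hv, if_neg (show ¬ (x + v.1 = 0) from fun h => hv ((QReg.add_eq_zero_iff x v.1).1 h)),
        mul_zero]
  rw [hL, hR]

/-- **GNW Lemma 4.3 (qubits): `R(T)` commutes with `C^{⊗t}` for every Clifford circuit `C`.**
[cite: GrossNezamiWalter2021, Lem. 4.3 (arXiv numbering; Lem. 4.5 published)] -/
theorem cliffordCodeOperator_mem_cliffordCommutant {T : Finset (Col t)} (hT : IsLagr T) (n : ℕ) :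
    cliffordCodeOperator T n ∈ cliffordCommutant t n := by
  rw [mem_cliffordCommutant_iff_placements]
  intro C hC
  rcases placements_clifford_iff.1 hC with ⟨e, rfl⟩ | ⟨e, rfl⟩ | ⟨e, rfl⟩
  · -- Hadamard
    rw [commute_hGate_iff]
    intro V
    simp_rw [entryFun_R_update]
    have := hada_core hT (V (e 0)).1 (V (e 0)).2
    simp_rw [← mul_assoc, ← Finset.sum_mul, this, Finset.sum_mul]
    refine Finset.sum_congr rfl fun y' _ => ?_
    ring
  · -- phase gate
    rw [commute_sGate_iff]
    intro V
    rw [entryFun_cliffordCodeOperator]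
    split_ifs with h
    · rw [mul_one, one_mul, prod_cI_eq_of_qchar_eq_one (hT.iso _ (h (e 0)))]
    · rw [mul_zero, zero_mul]
  · -- CNOT
    rw [commute_cnot_iff]
    intro V
    have hab : e 0 ≠ e 1 := fun h => by simpa using e.injective h
    rw [entryFun_R_update, entryFun_R_update]
    by_cases ha : V (e 0) ∈ T
    · have key : ((V (e 1)).1 + (V (e 0)).1, (V (e 1)).2) ∈ T ↔
          ((V (e 1)).1, (V (e 1)).2 + (V (e 0)).2) ∈ T := by
        constructor
        · intro h
          have := hT.isSub.add_mem _ h _ ha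
          convert this using 1
          exact Prod.ext (QReg.add_add_cancel_right _ _).symm rfl
        · intro h
          have := hT.isSub.add_mem _ h _ ha
          convert this using 1
          exact Prod.ext rfl (QReg.add_add_cancel_right _ _).symm
      by_cases hP : ((V (e 1)).1 + (V (e 0)).1, (V (e 1)).2) ∈ T
      · rw [if_pos hP, if_pos (key.1 hP)]
      · rw [if_neg hP, if_neg (fun hQ => hP (key.2 hQ))]
    · have h0 : ¬ ∀ i', i' ≠ e 1 → V i' ∈ T := fun h => ha (h (e 0) hab)
      rw [if_neg h0, mul_zero, mul_zero]

end Commutant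

/-! ### Assembly of the commutant theorem -/

section Assembly

variable {n : ℕ}

/-- The two descriptions of `Σ_{t,t}(2)` agree (`+` on `Col t` is coordinatewise xor, `1` is the
all-ones vector, and `χ(v) = 1 ↔ |x| ≡ |y| (mod 4)`). [cite: GrossNezamiWalter2021, Def. 4.1] -/
theorem isLagr_iff (T : Finset (Col t)) : IsLagr T ↔ IsStochasticLagrangian T := by
  constructor
  · intro h
    exact ⟨h.card_eq, h.one_mem, fun p hp q hq => h.isSub.add_mem p hp q hq,
      fun p hp => (qchar_eq_one_iff p).1 (h.iso p hp)⟩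
  · intro h
    exact ⟨h.card_eq, h.one_mem, ⟨h.zero_mem, fun p hp q hq => h.xor_mem p hp q hq⟩,
      fun p hp => (qchar_eq_one_iff p).2 (h.weight_mod_four p hp)⟩

/-- **Part (i), `t ≥ 1`: `|Σ_{t,t}(2)| = ∏_{k=0}^{t-2} (2^k + 1)`.**
[cite: GrossNezamiWalter2021, Thm. 4.8 (arXiv numbering; Thm. 4.10 published)] -/
theorem natCard_stochasticLagrangian (ht : 1 ≤ t) :
    Nat.card {T : Finset (QReg t × QReg t) // IsStochasticLagrangian T} =
      ∏ k ∈ Finset.range (t - 1), (2 ^ k + 1) := by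
  classical
  rw [Nat.card_eq_fintype_card, Fintype.card_subtype, ← card_lagrAbove_pair ht]
  congr 1
  ext T
  simp only [Finset.mem_filter, Finset.mem_univ, true_and, mem_lagrAbove, isLagr_iff]
  constructor
  · intro h
    refine ⟨h, ?_⟩
    intro v hv
    simp only [Finset.mem_insert, Finset.mem_singleton] at hv
    rcases hv with rfl | rfl
    · exact h.zero_mem
    · exact h.one_mem
  · exact fun h => h.1

/-- The reference tuple of `T` detects `T` among the Lagrangians.
[cite: GrossNezamiWalter2021, proof of Lem. 4.5 (δ_{T,T'})] -/
theorem refCols_gen_mem_iff (ht : 1 ≤ t) (hn : t - 1 ≤ n) {T T' : Finset (Col t)} (hT : IsLagr T)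
    (hT' : IsLagr T') : (∀ i, refCols (hT.gen ht) n i ∈ T') ↔ T = T' := by
  obtain ⟨hg, _, hgT⟩ := hT.gen_spec ht
  constructor
  · intro h
    apply Finset.eq_of_subset_of_card_le _ (by rw [hT.card_eq, hT'.card_eq])
    rw [← hgT]
    refine adjoin_subset hT'.isSub (spanF_subset hT'.isSub fun i => ?_) hT'.one_mem
    have e : hT.gen ht i = refCols (hT.gen ht) n ⟨i, by omega⟩ := by
      unfold refCols
      rw [dif_pos i.isLt]
    rw [e]
    exact h _
  · rintro rfl i
    exact refCols_mem hT.isSub hT.one_mem hg i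

/-- **Part (ii), `t ≥ 1`: the `R(T)`, `T ∈ Σ_{t,t}(2)`, are linearly independent for `n ≥ t - 1`.**
[cite: GrossNezamiWalter2021, Lem. 4.5 (arXiv numbering; Lem. 4.7 published)] -/
theorem linearIndependent_cliffordCodeOperator (ht : 1 ≤ t) (hn : t - 1 ≤ n) :
    LinearIndependent ℂ (fun T : {T : Finset (QReg t × QReg t) // IsStochasticLagrangian T} =>
      cliffordCodeOperator T.1 n) := by
  classical
  rw [Fintype.linearIndependent_iff]
  intro g hg T
  have hT : IsLagr T.1 := (isLagr_iff _).2 T.2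
  have key : ∀ T' : {T : Finset (QReg t × QReg t) // IsStochasticLagrangian T},
      (∀ i, refCols (hT.gen ht) n i ∈ T'.1) ↔ T' = T := by
    intro T'
    rw [refCols_gen_mem_iff ht hn hT ((isLagr_iff _).2 T'.2), eq_comm, Subtype.ext_iff]
  have e : ∀ T' : {T : Finset (QReg t × QReg t) // IsStochasticLagrangian T},
      entryFun (cliffordCodeOperator T'.1 n) (refCols (hT.gen ht) n) = if T' = T then 1 else 0 := by
    intro T'
    rw [entryFun_cliffordCodeOperator]
    by_cases h : T' = T
    · rw [if_pos h, if_pos ((key T').2 h)]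
    · rw [if_neg h, if_neg (fun h' => h ((key T').1 h'))]
  have h2 : entryFun (∑ T', g T' • cliffordCodeOperator T'.1 n) (refCols (hT.gen ht) n) = g T := by
    rw [← entryFunₗ_apply, map_sum]
    simp only [map_smul, entryFunₗ_apply, Finset.sum_apply, Pi.smul_apply, smul_eq_mul, e, mul_ite,
      mul_one, mul_zero, Finset.sum_ite_eq', Finset.mem_univ, if_true]
  have h0 : entryFun (0 : Matrix (QReg (t * n)) (QReg (t * n)) ℂ) (refCols (hT.gen ht) n) = 0 := rfl
  rw [hg, h0] at h2
  exact h2.symm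

/-- **Part (iii), `t ≥ 1`: the `R(T)` span the commutant for `n ≥ t - 1`** (`⊆` by Lemma 4.3,
`⊇` by the vanishing lemma: `dim ≤ |Σ_{t,t}(2)|`).
[cite: GrossNezamiWalter2021, Thm. 4.3 / proof of (thm:commutant)] -/
theorem span_cliffordCodeOperator_eq (ht : 1 ≤ t) (hn : t - 1 ≤ n) :
    Submodule.span ℂ (Set.range fun T : {T : Finset (QReg t × QReg t) // IsStochasticLagrangian T} =>
        cliffordCodeOperator T.1 n) =
      Subalgebra.toSubmodule (cliffordCommutant t n) := by
  classical
  set W := Subalgebra.toSubmodule (cliffordCommutant t n) with hW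
  have hmem : ∀ T : {T : Finset (QReg t × QReg t) // IsStochasticLagrangian T},
      cliffordCodeOperator T.1 n ∈ W := fun T =>
    cliffordCodeOperator_mem_cliffordCommutant ((isLagr_iff _).2 T.2) n
  apply le_antisymm
  · rw [Submodule.span_le]
    rintro _ ⟨T, rfl⟩
    exact hmem T
  · let RW : {T : Finset (QReg t × QReg t) // IsStochasticLagrangian T} → W := fun T => ⟨_, hmem T⟩
    have hli : LinearIndependent ℂ RW := by
      apply LinearIndependent.of_comp W.subtype
      exact linearIndependent_cliffordCodeOperator ht hn
    let L : W →ₗ[ℂ] ({T : Finset (QReg t × QReg t) // IsStochasticLagrangian T} → ℂ) :=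
      { toFun := fun A T => entryFun A.1 (refCols (((isLagr_iff _).2 T.2).gen ht) n)
        map_add' := fun _ _ => rfl
        map_smul' := fun _ _ => rfl }
    have hL : Function.Injective L := by
      intro A B hAB
      rw [← sub_eq_zero]
      have h0 : L (A - B) = 0 := by rw [map_sub, hAB, sub_self]
      apply Subtype.ext
      apply eq_of_entryFun_eq
      funext V
      have hinv : IsCliffInv t n (entryFun (A - B).1) := isCliffInv_entryFun (A - B).2
      rw [hinv.vanishing ht hn (fun T hT => congrFun h0 ⟨T, (isLagr_iff T).1 hT⟩) V]
      rfl
    have hfin : Module.finrank ℂ W ≤ Fintype.card {T : Finset (QReg t × QReg t) // IsStochasticLagrangian T} := by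
      have := LinearMap.finrank_le_finrank_of_injective hL
      rwa [Module.finrank_fintype_fun_eq_card] at this
    have hcard : Fintype.card {T : Finset (QReg t × QReg t) // IsStochasticLagrangian T} =
        Module.finrank ℂ W :=
      le_antisymm hli.fintype_card_le_finrank hfin
    have hspan : Submodule.span ℂ (Set.range RW) = ⊤ := hli.span_eq_top_of_card_eq_finrank' hcard
    intro A hA
    have hA' : (⟨A, hA⟩ : W) ∈ Submodule.span ℂ (Set.range RW) := by
      rw [hspan]
      trivial
    have := Submodule.apply_mem_span_image_of_mem_span W.subtype hA'
    rw [← Set.range_comp] at this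
    exact this

/-! ### The degenerate case `t = 0` -/

/-- `Σ_{0,0}(2) = {𝔽₂^0}`. [folklore] -/
theorem isStochasticLagrangian_zero_iff (T : Finset (Col 0)) :
    IsStochasticLagrangian T ↔ T = Finset.univ := by
  constructor
  · intro h
    apply Finset.eq_univ_of_card
    rw [h.card_eq]
    simp
  · rintro rfl
    refine ⟨by simp, Finset.mem_univ _, fun _ _ _ _ => Finset.mem_univ _, fun p _ => by simp⟩

/-- `Σ_{0,0}(2)` has exactly one element. [folklore] -/
abbrev uniqueLagrZero : Unique {T : Finset (Col 0) // IsStochasticLagrangian T} where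
  default := ⟨Finset.univ, (isStochasticLagrangian_zero_iff _).2 rfl⟩
  uniq T := Subtype.ext ((isStochasticLagrangian_zero_iff _).1 T.2)

/-- The register `QReg (0 * n)` has exactly one element. [folklore] -/
abbrev uniqueQRegZero (n : ℕ) : Unique (QReg (0 * n)) where
  default := fun _ => false
  uniq _ := funext fun k => False.elim (by have h := k.isLt; simp at h)

/-- Auxiliary (theorem `mul_comm_of_unique_qreg`): mul comm of unique qreg. [folklore] -/
theorem mul_comm_of_unique_qreg (A B : Matrix (QReg (0 * n)) (QReg (0 * n)) ℂ) : A * B = B * A := by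
  letI := uniqueQRegZero n
  ext i j
  rw [Subsingleton.elim i default, Subsingleton.elim j default]
  simp only [Matrix.mul_apply, Fintype.sum_unique]
  rw [mul_comm]
  rfl

/-- Auxiliary (theorem `cliffordCommutantTheorem_zero`): cliffordCommutantTheorem zero. [folklore] -/
theorem cliffordCommutantTheorem_zero (n : ℕ) :
    Nat.card {T : Finset (QReg 0 × QReg 0) // IsStochasticLagrangian T} =
        ∏ k ∈ Finset.range (0 - 1), (2 ^ k + 1) ∧
      LinearIndependent ℂ
        (fun T : {T : Finset (QReg 0 × QReg 0) // IsStochasticLagrangian T} =>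
          cliffordCodeOperator T.1 n) ∧
      Submodule.span ℂ
          (Set.range fun T : {T : Finset (QReg 0 × QReg 0) // IsStochasticLagrangian T} =>
            cliffordCodeOperator T.1 n) =
        Subalgebra.toSubmodule (cliffordCommutant 0 n) := by
  letI := uniqueLagrZero
  letI := uniqueQRegZero n
  have hR : ∀ T : {T : Finset (QReg 0 × QReg 0) // IsStochasticLagrangian T},
      ∀ z w : QReg (0 * n), cliffordCodeOperator T.1 n z w = 1 := by
    intro T z w
    rw [(isStochasticLagrangian_zero_iff _).1 T.2, cliffordCodeOperator_apply_eq_ite,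
      if_pos (fun i => Finset.mem_univ _)]
  refine ⟨?_, ?_, ?_⟩
  · rw [Nat.card_unique]
    rfl
  · rw [linearIndependent_unique_iff]
    intro h
    have := congrFun (congrFun h default) default
    rw [hR] at this
    exact one_ne_zero this
  · apply le_antisymm
    · rw [Submodule.span_le]
      rintro _ ⟨T, rfl⟩
      show cliffordCodeOperator T.1 n ∈ cliffordCommutant 0 n
      rw [mem_cliffordCommutant_iff]
      intro C _
      exact mul_comm_of_unique_qreg _ _
    · intro A _
      have hA : A = A default default • cliffordCodeOperator (default : {T : Finset (QReg 0 × QReg 0) //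
          IsStochasticLagrangian T}).1 n := by
        ext i j
        rw [Subsingleton.elim i default, Subsingleton.elim j default, Matrix.smul_apply, hR, smul_eq_mul,
          mul_one]
      rw [hA]
      exact Submodule.smul_mem _ _ (Submodule.subset_span ⟨default, rfl⟩)

end Assembly

end CliffordCommutant

/-- **Gross–Nezami–Walter, Theorem 4.3 (qubit case, `d = 2`), discharged.** For `n ≥ t - 1` the
Clifford code operators `R(T) = r(T)^{⊗n}`, `T ∈ Σ_{t,t}(2)`, are `∏_{k=0}^{t-2} (2^k+1)` linearly
independent operators spanning the commutant of the `t`-th tensor power action of the `n`-qubit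
Clifford circuits. Proof: (i) `natCard_stochasticLagrangian` (an elementary double-counting
recursion for the number of stochastic Lagrangians, in place of [GNW21, Thm. 4.8]'s
parametrisation), (ii) `linearIndependent_cliffordCodeOperator` ([GNW21, Lem. 4.5] verbatim),
(iii) `⊆`: `cliffordCodeOperator_mem_cliffordCommutant` ([GNW21, Lem. 4.3], generator by generator);
`⊇`: the vanishing lemma `IsCliffInv.vanishing` bounds the dimension of the commutant by
`|Σ_{t,t}(2)|` directly in the vectorised (code) picture, replacing the Weyl-twirl / symplectic
orbit count of [GNW21, Lem. 4.6, Thm. 4.7]; `t = 0` is `cliffordCommutantTheorem_zero`.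
[cite: GrossNezamiWalter2021, Thm. 4.3 (= Thm. 1.1); arXiv:1712.08628 §4.1] -/
theorem CliffordCommutantTheorem_holds : CliffordCommutantTheorem := by
  intro t n htn
  rcases Nat.eq_zero_or_pos t with rfl | ht
  · exact CliffordCommutant.cliffordCommutantTheorem_zero n
  · exact ⟨CliffordCommutant.natCard_stochasticLagrangian ht,
      CliffordCommutant.linearIndependent_cliffordCodeOperator ht htn,
      CliffordCommutant.span_cliffordCodeOperator_eq ht htn⟩

end Literature.Computability.QuantumComplexity
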